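import Literature.MathematicalPhysics.QuantumFieldTheory.Balaban1983to89.B2Eq268GaugeAway
import Literature.MathematicalPhysics.QuantumFieldTheory.Balaban1983to89.B2

/-!
# `Balaban1983to89.B2Lemma24Proof` — [Balaban1982Higgs2] **Lemma 2.4** (2.65)–(2.66) p. 572 and its printed proof
# (2.67)–(2.77) pp. 572–574 («the constant field A₀ can be "gauged out"»): the row's decl of record `B2.Lemma24Printed`
# PROVED for a model family built on the B4 lineage's fine box, with (2.68), (2.69)–(2.75), (2.76), (2.77)
# KERNEL-CHECKED and Propositions 2.2 / I.2.2 as hypothesis shapes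

statement-level skeleton of published theorems with citation tags; proofs where landed; nothing here is a claim about the Yang–Mills mass gap

CITATION HEADER.  T. Bałaban, *(Higgs)₂,₃ quantum fields in a finite volume. II. An upper bound*, Commun. Math. Phys.
**86** (1982) 555–594, doi:10.1007/bf01214890 [Balaban1982Higgs2] (cell paper B2; journal page = PDF page + 554; pp. 570–574
READ AS IMAGES on the ×2 renders `run/shared/lean/pub/pub-balaban/b2b-balaban-ref1/pages/1982-cmp86-higgs23-II/
1982-cmp86-higgs23-II-p016…p020-x2.png`); operators of T. Bałaban, *… III. Regularity and decay of lattice Green's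
functions*, Commun. Math. Phys. **89** (1983) 571–597 [Balaban1983RegularityDecay] (= B4) as typed by the lineage
`B4GaugeCovariance` → … → `B4Lemma22L1Stair`, with the zero-field box theorems `B4Thm110ZeroBox(Deriv)` (B4 Theorem (1.10)
at `A = 0`, PROVED there).  Cell `lit-balaban` (HOME `run/shared/lean/pub/lit-balaban/`), Phase-2 proof seat **p23** gen 5,
unit `lit-balaban-p23-g5`; SKELETON row **B2.Lem2.4** (decl of record `…B2.Lemma24Printed` over `…B2.L24Setting`,
UNCHANGED), kind «model instance» (PHASE2-TARGETS §G.1); fold owner r02, referee ref-4; support file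
`B2Eq268GaugeAway` (p249407: (2.68) remainder, (2.71)–(2.75)).

WHAT IS PRINTED (verbatim, p. 572 [PDF 18]).  *"**Lemma 2.4.** Under the restrictions (2.55) we have
φ^{(k)}(x) = U(A^{(k)}(Γ^{(k)}_{x,y}))φ(y) + O(p(L^kε)) = (Q_k^*(A^{(k)})φ)(x) + O(p(L^kε)), for x ∈ B^k(y), y ∈ Λ₇^{(k−1)′}, (2.65)
(D^η_{A^{(k)}}φ^{(k)})(b) = O(p(L^kε)) for b ⊂ B^k(Λ₇^{(k−1)′}). (2.66)
Let us define □₁, □₂ as the sums of large blocks contained in Λ₇^{(k−1)′} and distant from the point y less than 2r(L^kε),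
4r(L^kε) respectively, and let us denote □ = B^k(□₂). Of course □ ⊂ B^k(Λ₂^{(k−1)′}). Using Proposition 2.2 and the
restrictions (2.55) we get φ^{(k)}(x) = (a_kG_k(□, A^{(k)})Q_k^*(A^{(k)})□₁φ)(x) + O((L^kε)^κ), x ∈ B^k(y), (2.67) and the same
equality for the covariant derivative of φ^{(k)}. From the property (2.60) we have the inequality |A^{(k)}(x) − A^{(k)}(y)|
≦ O(p(L^kε)r(L^kε)). Let us denote by A₀ a constant configuration equal to A^{(k)}(y) at each point, thus A^{(k)} − A₀ =
O(p(L^kε)r(L^kε)). Using the expansion formula (I.3.44) and Proposition I.2.2. we have […] = (a_kG_k(□, A₀)Q_k^*(A₀)□₁φ)(x)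
+ O((L^kε)^{κ₀}), κ₀ > 0, (2.68) and similarly for the derivative. Now the constant field A₀ can be "gauged out" from the last
expression above."* (2.69)–(2.77) and the concluding sentences of pp. 573–574 are quoted in the docstrings below and in
`B2Eq268GaugeAway`.

THE MODEL (one instance `Model fr Yo` = one step `k` and one block point `y`; dictionary in the docstring of `Model`).
The carrier is CONCRETE: `□` is the lineage's fine box `Box d ℓ k M = Π[0,L^kM_μ) ⊂ ℤ^{d+1}` with unit sites `□₂ = boxDom M`,
`A^{(k)}|_□ = Ã = constBond A₀ + A'` (`A₀ = A^{(k)}(y)` constant), `g = a_kG_k(□,Ã)Q_k^*(Ã)□₁φ` is [B4]'s typed (1.6)/(1.4)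
(`B4Lemma22ReduceZero.greenA`, `B2Eq268GaugeAway.avgA`), `φ^{(k)}|_□` is (2.56) in kernel form over the unit sites `Tout`
of `Λ₆` (`φk x = Σ_{y′}K_Ω(x,y′)φ(y′)`), and the transporters are `U(κA(Γ^{(k)}_{y,x}))`.  The family data `Frame` fixes
`L`, the flow `U`, the window of `(a, m²)`, and the constants; the INPUTS are hypothesis fields of the instance, each the
shape of a printed input: Proposition 2.2 (2.58) on `Ω = B^k(Λ₂)` with its `δG`-clause (`kerΩ_far/near`, `dkerΩ_far/near`),
Proposition I.2.2 for `(□, A^{(k)})` (`sup_g`, `sup_Dg`), the size of `A^{(k)} − A₀` (`hA'`, `hτA`: «O(p(L^kε)r(L^kε))»),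
invertibility of `H_k(□,Ã)` (`hunit`), the scale products (`kap`, `sep*`, `θ_scale`, `τ_scale`: the printed
«O((L^kε)^{κ₀})», «r(L^kε)»-separation and (2.63)/(2.75) against the threshold `c₁λ(L^{k−1}ε)^{−1/4}` of (2.55)₄), and ONE
non-printed-shape input `remD` (below).  The restrictions (2.55) form the predicate `Model.Restr` (= `restr255`).

WHAT IS PROVED (every theorem from the lineage's definitions; 0 cited facts, no `sorry`; axioms standard).
§1 engines; §2 `box_roww`, `box_deriv_roww` ([B4] Theorem (1.10) at `A = 0` on the fine box, restated from
`B4Thm110ZeroBox(Deriv)`) with NAMED constants `δG, cG, δD, cD`; §3 **(2.76)** `eq276_site` and **(2.77)** `eq277_site`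
for the gauged main term `a_k(G_k(□)⊗1)Q_k^*□₁φ′` on the box — the decomposition (2.61)/(2.64) with `ζ ≡ 1`, the value
(2.75) `a_kG_k(□,0)Q_k^*1 = a_k/(a_k+m²)` (`B2Eq268GaugeAway.gk_rowsum`), and the PROVED kernel decay — NO Proposition-2.2
hypothesis enters here; §3b `remainder268_deriv_site` (the derivative of the (2.68) remainder up to its divergence-form
cross term); §4 the objects (`boxOneField`, `gVec`, `kerBox`, `dkerBox`, `dKer`, `contourTrans_constBond` =
«A₀(Γ_{y,y′}∪Γ^{(k)}_{y′,x′}∪Γ_{x′,y}) = 0», `fld_avgA_transpose` = the two forms of (2.65) agree); §5 `Frame`, `Model`,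
`Model.Restr`, `φk`, `dφk`, `dev265a/b`, `dev266`; §6 `lip_φ'` («After the gauge transformation we finally get |φ′(y″) −
φ′(y′)| ≦ O(1)p(L^kε)», EXACT by orthogonality), `main_site_le` ((2.74)+(2.76)), `target_site_le` (the transporter
comparison «U(A₀(Γ_{x,y}))φ(y) = U(A^{(k)}(Γ^{(k)}_{x,y}))φ(y) + O((L^kε)^{κ₀})»); §7 `outer_engine`, `loc267_site`,
`dloc267_site` (**(2.67)** and its derivative form from the Proposition-2.2 shapes); §8 `supN_g_le`, `sumD_le`, `rem_arith`
(the «O((L^kε)^{κ₀})» bookkeeping of (2.68) from Proposition I.2.2 and the scale hypotheses); §9 `value_site_le` (**(2.65)**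
pointwise, constant `C65`), `deriv_site_le` (**(2.66)** pointwise, constant `C66`), `lemma24_bounds`, and **row B2.Lem2.4**:
`lemma24Printed_model : B2.Lemma24Printed (famOf fr Yo)` for the family of ALL instances of a frame.

HONEST SCOPE.  (a) Hypothesis shapes, as in print: Proposition 2.2 on `Ω` (outer kernels abstract, only their rows at
`B^k(y)`), Proposition I.2.2 on `(□, A^{(k)})` (two sup bounds), invertibility of `H_k(□,Ã)`, and the scale products; their
provenance (Proposition I.2.1/[B4] for non-constant fields on `Ω`; the behaviour of `r(·)`, `λ(·)`, `e(·)`, `p(·)` across one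
scale) is NOT certified here.  (b) NOT PRINTED-SHAPE: the field `remD` bounds, at the points of `B^k(y)`, the single term
`D^η_{A₀}G_k(□,A₀)D^{η*}_{A₀}F_{1,k}(−A′)g` of the derivative of the (2.68) remainder; print covers it by «and similarly for
the derivative», but `A′ = A^{(k)} − A₀` has no compact support in `□`, so [B4] (2.32) does not apply at `∂□` and none of the
formalised members of [B4] (2.17) (`G`, `D^ηG`, `GD^{η*}` in `‖·‖_∞`, `‖·‖₁`) controls `D^ηGD^{η*}`; cell GAPS.md `G-B2-Lem24-D`.
The VALUE clause (2.65) does not use `remD`: its remainder (2.68) is fully proved (`B2Eq268GaugeAway.remainder268_sup`, the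
divergence-form term by duality).  (c) The restriction (2.55)₃ enters in the printed integrated covariant form (p. 573) with
free constants `r₁, r₂`; (2.55)₄ as `|φ| ≤ t_φ·p(L^{k−1}ε)`; (2.60) is replaced by its printed consequence «A^{(k)} − A₀ =
O(p(L^kε)r(L^kε))» in the per-bond form `|κA'_b| ≤ θ/L^k`, `|κA'(Γ)| ≤ τ`.  (d) One instance = one `(k, y)`; (2.66) ranges
over the bonds `(x, x+e_μ) ⊂ □` with `x ∈ B^k(y)`; the contour system is any system ending at the averaged point; the
colour group is any abelian orthogonal flow (`OrthFlow`).  (e) Constants explicit (`Frame.C65/C66/C68`), unoptimised.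
(f) Value = kernel certificate of the printed proof's architecture in the lineage's typed setting; NOT summit progress.
-/

namespace Literature.MathematicalPhysics.QuantumFieldTheory.Balaban1983to89.B2Lemma24Proof

open Finset Matrix
open scoped Kronecker
open Literature.MathematicalPhysics.QuantumFieldTheory.Balaban1983to89.B4GaugeCovariance
open Literature.MathematicalPhysics.QuantumFieldTheory.Balaban1983to89.B4Lower18Regular (e1 lsum contourTrans_kmul
  fieldLink_add transport_fieldLink)
open Literature.MathematicalPhysics.QuantumFieldTheory.Balaban1983to89.B4Lemma21Region (siteNorm covDeriv
  fld_covDeriv_mulVec_of_mem)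
open Literature.MathematicalPhysics.QuantumFieldTheory.Balaban1983to89.B4Reflection242 (nbrs boxDom blk)
open Literature.MathematicalPhysics.QuantumFieldTheory.Balaban1983to89.B4ContourShift (supNorm supNorm_nonneg)
open Literature.MathematicalPhysics.QuantumFieldTheory.Balaban1983to89.B4BoxCov237 (boxOpR)
open Literature.MathematicalPhysics.QuantumFieldTheory.Balaban1983to89.B4Lemma22Reduce231
open Literature.MathematicalPhysics.QuantumFieldTheory.Balaban1983to89.B4Lemma22ReduceZero (siteNorm_sum_le Box gk dk
  greenA greenA0 opA pertV derivA derivA0)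
open Literature.MathematicalPhysics.QuantumFieldTheory.Balaban1983to89.B4Lemma22ReduceDeriv (siteNorm_flow
  siteNorm_flow_sub_one_le fld_sub covDeriv_sub_supN_le_nbrs)
open Literature.MathematicalPhysics.QuantumFieldTheory.Balaban1983to89.B4Lemma22PertVSup (siteNorm_neg supN_neg
  supN_smul_le constBond_antisymm contourTrans_fieldLink fld_avgOp_transpose_mulVec)
open Literature.MathematicalPhysics.QuantumFieldTheory.Balaban1983to89.B4Thm110ZeroBox (thm110_zero_box_roww)
open Literature.MathematicalPhysics.QuantumFieldTheory.Balaban1983to89.B4Thm110ZeroBoxDeriv (thm110_zero_box_deriv_roww)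
open Literature.MathematicalPhysics.QuantumFieldTheory.Balaban1983to89.B2Eq268GaugeAway

noncomputable section

variable {ι : Type} [Fintype ι] [DecidableEq ι]

/-! ## §1 Engines: site norms of kernel sums; exponentially weighted row bounds -/

section Engine

variable {X : Type*} [Fintype X]

omit [DecidableEq ι] in
/-- `|Σ_x c(x)v(x)| ≤ Σ_x |c(x)|·|v(x)|`. [folklore] -/
private theorem siteNorm_sum_smul_le (c : X → ℝ) (v : X → ι → ℝ) :
    siteNorm (∑ x, c x • v x) ≤ ∑ x, |c x| * siteNorm (v x) := by
  refine (siteNorm_sum_le _ _).trans (sum_le_sum fun x _ => ?_)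
  rw [siteNorm_smul]

/-- ENGINE (a): a weighted row bound `Σ|c|e^{δs} ≤ C₀` (`δ, s ≥ 0`) gives `Σ|c| ≤ C₀`.
[cite: Balaban1983RegularityDecay, Theorem (1.10) p. 573] -/
private theorem wsum_const {c s : X → ℝ} {δ C₀ : ℝ} (hδ : 0 ≤ δ) (hs : ∀ x, 0 ≤ s x)
    (h : ∑ x, |c x| * Real.exp (δ * s x) ≤ C₀) : ∑ x, |c x| ≤ C₀ := by
  refine le_trans (sum_le_sum fun x _ => ?_) h
  have : 1 ≤ Real.exp (δ * s x) := Real.one_le_exp (mul_nonneg hδ (hs x))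
  nlinarith [abs_nonneg (c x)]

/-- ENGINE (b): `Σ|c|·s ≤ C₀/δ` (`δs ≤ e^{δs}`). [cite: Balaban1983RegularityDecay, Theorem (1.10) p. 573] -/
private theorem wsum_lin {c s : X → ℝ} {δ C₀ : ℝ} (hδ : 0 < δ)
    (h : ∑ x, |c x| * Real.exp (δ * s x) ≤ C₀) : ∑ x, |c x| * s x ≤ C₀ / δ := by
  rw [le_div_iff₀ hδ, sum_mul]
  refine le_trans (sum_le_sum fun x _ => ?_) h
  have : δ * s x ≤ Real.exp (δ * s x) := by
    have := Real.add_one_le_exp (δ * s x)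
    linarith
  nlinarith [abs_nonneg (c x)]

/-- ENGINE (c): the FAR part `Σ_{x : R ≤ s(x)}|c| ≤ e^{−δR}C₀`.
[cite: Balaban1983RegularityDecay, Theorem (1.10) p. 573] -/
private theorem wsum_far {c s : X → ℝ} {δ C₀ R : ℝ} (hδ : 0 ≤ δ)
    (h : ∑ x, |c x| * Real.exp (δ * s x) ≤ C₀) (P : X → Prop) [DecidablePred P] (hfar : ∀ x, P x → R ≤ s x) :
    ∑ x ∈ univ.filter P, |c x| ≤ Real.exp (-(δ * R)) * C₀ := by
  have hC : 0 ≤ C₀ := le_trans (sum_nonneg fun x _ => by positivity) h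
  have h1 : ∑ x ∈ univ.filter P, |c x| ≤ ∑ x ∈ univ.filter P, Real.exp (-(δ * R)) * (|c x| * Real.exp (δ * s x)) := by
    refine sum_le_sum fun x hx => ?_
    have hR := hfar x (mem_filter.1 hx).2
    have : 1 ≤ Real.exp (-(δ * R)) * Real.exp (δ * s x) := by
      rw [← Real.exp_add]
      exact Real.one_le_exp (by nlinarith)
    nlinarith [abs_nonneg (c x)]
  refine h1.trans ?_
  rw [← mul_sum]
  refine mul_le_mul_of_nonneg_left ?_ (Real.exp_pos _).le
  exact (sum_le_univ_sum_of_nonneg fun x => by positivity).trans h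

omit [Fintype X] [DecidableEq ι] in
/-- **BLOCK EXPANSION**: `(TΨ)(x) = Σ_y T[x,y]·Ψ(y)` with the `ι×ι` blocks `T[x,y]` of a matrix on `X×ι ← Y×ι`. [folklore] -/
private theorem fld_mulVec_blocks {Y : Type*} [Fintype Y] (T : Matrix (X × ι) (Y × ι) ℝ) (Ψ : Y × ι → ℝ) (x : X) :
    fld (T *ᵥ Ψ) x = ∑ y, (Matrix.of fun i j => T (x, i) (y, j)) *ᵥ fld Ψ y := by
  funext i
  simp only [fld_apply, mulVec, dotProduct, Finset.sum_apply, Matrix.of_apply, Fintype.sum_prod_type]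

end Engine

/-! ## §2 The constants `δ₀, c₀` of the zero-field box theorems (B4 Theorem (1.10) at `A = 0`, values and derivatives),
NAMED, so that the model's scale hypotheses can refer to them -/

section Consts

/-- B4 Theorem (1.10) at `A = 0` on the fine box, values: `Σ_{x′}|G_k(□;x,x′)|e^{δ₀|x−x′|_∞/n} ≤ c₀`, uniformly on the
window (`B4Thm110ZeroBox.thm110_zero_box_roww` in the lineage's `gk` notation).
[cite: Balaban1983RegularityDecay, Theorem (1.10) p. 573] -/
theorem box_roww (d ℓ : ℕ) (hℓ : 1 ≤ ℓ) (amin aplus m2plus : ℝ) (ha : 0 < amin) :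
    ∃ δ₀ c₀ : ℝ, 0 < δ₀ ∧ 0 < c₀ ∧
      ∀ (k : ℕ), 1 ≤ k → ∀ (a m2 : ℝ), amin ≤ a → a ≤ aplus → 0 ≤ m2 → m2 ≤ m2plus →
        ∀ (M : Fin (d + 1) → ℕ), (∀ i, 1 ≤ M i) → ∀ x : ↥(Box d ℓ k M),
          ∑ x' : ↥(Box d ℓ k M), |gk d ℓ k a m2 M x x'|
              * Real.exp (δ₀ * (supNorm (x.1 - x'.1) / (((ℓ + 1) ^ k : ℕ) : ℝ))) ≤ c₀ := by
  obtain ⟨δ₀, c₀, hδ, hc, h⟩ := thm110_zero_box_roww d ℓ hℓ amin aplus m2plus ha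
  refine ⟨δ₀, c₀, hδ, hc, fun k hk a m2 e1' e2 e3 e4 M hM x => ?_⟩
  have := h k hk a m2 e1' e2 e3 e4 M hM x
  simp only [mul_div_assoc] at this
  exact this

/-- B4 Theorem (1.10) at `A = 0` on the fine box, derivatives: the weighted row bound for the differenced rows
`n(G_k(□;x+e_μ,x′) − G_k(□;x,x′))` (`B4Thm110ZeroBoxDeriv.thm110_zero_box_deriv_roww`).
[cite: Balaban1983RegularityDecay, Theorem (1.10) p. 573] -/
theorem box_deriv_roww (d ℓ : ℕ) (hℓ : 1 ≤ ℓ) (amin aplus m2plus : ℝ) (ha : 0 < amin) :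
    ∃ δ₀ c₀ : ℝ, 0 < δ₀ ∧ 0 < c₀ ∧
      ∀ (k : ℕ), 1 ≤ k → ∀ (a m2 : ℝ), amin ≤ a → a ≤ aplus → 0 ≤ m2 → m2 ≤ m2plus →
        ∀ (M : Fin (d + 1) → ℕ), (∀ i, 1 ≤ M i) → ∀ (μ : Fin (d + 1)) (x : ↥(Box d ℓ k M))
          (h : x.1 + e1 μ ∈ Box d ℓ k M),
          ∑ x' : ↥(Box d ℓ k M), |(((ℓ + 1) ^ k : ℕ) : ℝ) * (gk d ℓ k a m2 M ⟨x.1 + e1 μ, h⟩ x' - gk d ℓ k a m2 M x x')|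
              * Real.exp (δ₀ * (supNorm (x.1 - x'.1) / (((ℓ + 1) ^ k : ℕ) : ℝ))) ≤ c₀ := by
  obtain ⟨δ₀, c₀, hδ, hc, h⟩ := thm110_zero_box_deriv_roww d ℓ hℓ amin aplus m2plus ha
  refine ⟨δ₀, c₀, hδ, hc, fun k hk a m2 e1' e2 e3 e4 M hM μ x hx => ?_⟩
  have := h k hk a m2 e1' e2 e3 e4 M hM μ x ⟨x.1 + e1 μ, hx⟩ rfl
  simp only [mul_div_assoc] at this
  exact this

/-- `δ₀` of `box_roww` (decay rate of `G_k(□)`, uniform on the window), NAMED.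
[cite: Balaban1983RegularityDecay, Theorem (1.10) p. 573] -/
def δG (d ℓ : ℕ) (hℓ : 1 ≤ ℓ) (amin aplus m2plus : ℝ) (ha : 0 < amin) : ℝ :=
  (box_roww d ℓ hℓ amin aplus m2plus ha).choose

/-- `c₀` of `box_roww`, NAMED. [cite: Balaban1983RegularityDecay, Theorem (1.10) p. 573] -/
def cG (d ℓ : ℕ) (hℓ : 1 ≤ ℓ) (amin aplus m2plus : ℝ) (ha : 0 < amin) : ℝ :=
  (box_roww d ℓ hℓ amin aplus m2plus ha).choose_spec.choose

/-- `δ₀` of `box_deriv_roww` (decay rate of `∂^ηG_k(□)`), NAMED. [cite: Balaban1983RegularityDecay, Theorem (1.10) p. 573] -/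
def δD (d ℓ : ℕ) (hℓ : 1 ≤ ℓ) (amin aplus m2plus : ℝ) (ha : 0 < amin) : ℝ :=
  (box_deriv_roww d ℓ hℓ amin aplus m2plus ha).choose

/-- `c₀` of `box_deriv_roww`, NAMED. [cite: Balaban1983RegularityDecay, Theorem (1.10) p. 573] -/
def cD (d ℓ : ℕ) (hℓ : 1 ≤ ℓ) (amin aplus m2plus : ℝ) (ha : 0 < amin) : ℝ :=
  (box_deriv_roww d ℓ hℓ amin aplus m2plus ha).choose_spec.choose

/-- the specification of `δG, cG`. [cite: Balaban1983RegularityDecay, Theorem (1.10) p. 573] -/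
theorem δG_spec (d ℓ : ℕ) (hℓ : 1 ≤ ℓ) (amin aplus m2plus : ℝ) (ha : 0 < amin) :
    0 < δG d ℓ hℓ amin aplus m2plus ha ∧ 0 < cG d ℓ hℓ amin aplus m2plus ha ∧
      ∀ (k : ℕ), 1 ≤ k → ∀ (a m2 : ℝ), amin ≤ a → a ≤ aplus → 0 ≤ m2 → m2 ≤ m2plus →
        ∀ (M : Fin (d + 1) → ℕ), (∀ i, 1 ≤ M i) → ∀ x : ↥(Box d ℓ k M),
          ∑ x' : ↥(Box d ℓ k M), |gk d ℓ k a m2 M x x'|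
              * Real.exp (δG d ℓ hℓ amin aplus m2plus ha * (supNorm (x.1 - x'.1) / (((ℓ + 1) ^ k : ℕ) : ℝ)))
            ≤ cG d ℓ hℓ amin aplus m2plus ha :=
  (box_roww d ℓ hℓ amin aplus m2plus ha).choose_spec.choose_spec

/-- the specification of `δD, cD`. [cite: Balaban1983RegularityDecay, Theorem (1.10) p. 573] -/
theorem δD_spec (d ℓ : ℕ) (hℓ : 1 ≤ ℓ) (amin aplus m2plus : ℝ) (ha : 0 < amin) :
    0 < δD d ℓ hℓ amin aplus m2plus ha ∧ 0 < cD d ℓ hℓ amin aplus m2plus ha ∧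
      ∀ (k : ℕ), 1 ≤ k → ∀ (a m2 : ℝ), amin ≤ a → a ≤ aplus → 0 ≤ m2 → m2 ≤ m2plus →
        ∀ (M : Fin (d + 1) → ℕ), (∀ i, 1 ≤ M i) → ∀ (μ : Fin (d + 1)) (x : ↥(Box d ℓ k M))
          (h : x.1 + e1 μ ∈ Box d ℓ k M),
          ∑ x' : ↥(Box d ℓ k M), |(((ℓ + 1) ^ k : ℕ) : ℝ) * (gk d ℓ k a m2 M ⟨x.1 + e1 μ, h⟩ x' - gk d ℓ k a m2 M x x')|
              * Real.exp (δD d ℓ hℓ amin aplus m2plus ha * (supNorm (x.1 - x'.1) / (((ℓ + 1) ^ k : ℕ) : ℝ)))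
            ≤ cD d ℓ hℓ amin aplus m2plus ha :=
  (box_deriv_roww d ℓ hℓ amin aplus m2plus ha).choose_spec.choose_spec

end Consts

/-! ## §3 (2.76) and its derivative form on the box: «the same reasoning … as to A^{(k)} in the proof of Lemma 2.3» for
the configuration `a_kG_k(□,0)Q_k^*□₁φ′` — decomposition (2.61) with `ζ ≡ 1`, the zero-field kernel decay of [B4] Theorem
(1.10) (PROVED in the tree: `box_roww`, `box_deriv_roww`) and the value (2.75) -/

section Eq276

variable {d : ℕ}

omit [Fintype ι] [DecidableEq ι] in
/-- re-centring a kernel sum: `Σ G(x′)v(x′) = Σ G(x′)(v(x′) − v₀) + (ΣG)v₀` (the decomposition (2.61) with `ζ ≡ 1`).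
[cite: Balaban1982Higgs2, (2.61) p. 571, (2.76) p. 573] -/
theorem sum_smul_recenter {X : Type*} (S : Finset X) (G : X → ℝ) (v : X → ι → ℝ) (v₀ : ι → ℝ) :
    ∑ x ∈ S, G x • v x = ∑ x ∈ S, G x • (v x - v₀) + (∑ x ∈ S, G x) • v₀ := by
  rw [Finset.sum_smul, ← Finset.sum_add_distrib]
  exact Finset.sum_congr rfl fun x _ => by rw [smul_sub, sub_add_cancel]

omit [DecidableEq ι] in
/-- THE ENGINE OF (2.76): for a kernel row `G` with `Σ_{x′}|G(x′)|e^{δs(x′)} ≤ c₀` (`δ > 0`, `s ≥ 0`), a block field `v`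
supported in `□₁` with `|v(y(x′)) − v₀| ≤ q(r₁ + r₂s(x′))` on `□₁`-blocks, `|v₀| ≤ t_φq`, and `R₁ ≤ s(x′)` off `□₁`:
`|Σ_{x′}G(x′)(v(y(x′)) − v₀)| ≤ c₀(r₁ + r₂/δ)q + e^{−δR₁}c₀t_φq` («Using Proposition 2.2 and the restrictions (2.55) we can
estimate the first two terms in (2.61) by O(1)p(L^kε)»). [cite: Balaban1982Higgs2, (2.61) p. 571, (2.76) p. 573] -/
theorem recentered_sum_le {X Y : Type*} [Fintype X] [DecidableEq Y] {G s : X → ℝ} {δ c₀ : ℝ} (hδ : 0 < δ)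
    (hs : ∀ x', 0 ≤ s x') (hrow : ∑ x', |G x'| * Real.exp (δ * s x') ≤ c₀) (sq1 : Finset Y) (b : X → Y)
    (v : Y → ι → ℝ) (v₀ : ι → ℝ) {q tφ r₁ r₂ R₁ : ℝ} (hq : 0 ≤ q) (hr₁ : 0 ≤ r₁) (hr₂ : 0 ≤ r₂)
    (hsupp : ∀ y', y' ∉ sq1 → v y' = 0) (hv₀ : siteNorm v₀ ≤ tφ * q)
    (hlip : ∀ x', b x' ∈ sq1 → siteNorm (v (b x') - v₀) ≤ q * (r₁ + r₂ * s x'))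
    (hfar : ∀ x', b x' ∉ sq1 → R₁ ≤ s x') :
    siteNorm (∑ x', G x' • (v (b x') - v₀)) ≤ c₀ * (r₁ + r₂ / δ) * q + Real.exp (-(δ * R₁)) * c₀ * tφ * q := by
  have hc₀ : 0 ≤ c₀ := le_trans (sum_nonneg fun x _ => by positivity) hrow
  have hA := wsum_const hδ.le hs hrow
  have hB := wsum_lin hδ hrow
  have hC := wsum_far hδ.le hrow (fun x' => b x' ∉ sq1) hfar
  refine (siteNorm_sum_smul_le _ _).trans ?_
  rw [← Finset.sum_filter_add_sum_filter_not univ (fun x' => b x' ∈ sq1)]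
  have hnear : ∑ x' ∈ univ.filter (fun x' => b x' ∈ sq1), |G x'| * siteNorm (v (b x') - v₀)
      ≤ c₀ * (r₁ + r₂ / δ) * q := by
    calc ∑ x' ∈ univ.filter (fun x' => b x' ∈ sq1), |G x'| * siteNorm (v (b x') - v₀)
        ≤ ∑ x' ∈ univ.filter (fun x' => b x' ∈ sq1), |G x'| * (q * (r₁ + r₂ * s x')) :=
          sum_le_sum fun x' hx' => mul_le_mul_of_nonneg_left (hlip x' (mem_filter.1 hx').2) (abs_nonneg _)
      _ ≤ ∑ x', |G x'| * (q * (r₁ + r₂ * s x')) :=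
          sum_le_univ_sum_of_nonneg fun x' => mul_nonneg (abs_nonneg _)
            (mul_nonneg hq (add_nonneg hr₁ (mul_nonneg hr₂ (hs x'))))
      _ = q * r₁ * ∑ x', |G x'| + q * r₂ * ∑ x', |G x'| * s x' := by
          rw [mul_sum, mul_sum, ← sum_add_distrib]
          exact sum_congr rfl fun x' _ => by ring
      _ ≤ q * r₁ * c₀ + q * r₂ * (c₀ / δ) :=
          add_le_add (mul_le_mul_of_nonneg_left hA (mul_nonneg hq hr₁))
            (mul_le_mul_of_nonneg_left hB (mul_nonneg hq hr₂))
      _ = c₀ * (r₁ + r₂ / δ) * q := by ring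
  have hfarS : ∑ x' ∈ univ.filter (fun x' => ¬ b x' ∈ sq1), |G x'| * siteNorm (v (b x') - v₀)
      ≤ Real.exp (-(δ * R₁)) * c₀ * tφ * q := by
    calc ∑ x' ∈ univ.filter (fun x' => ¬ b x' ∈ sq1), |G x'| * siteNorm (v (b x') - v₀)
        = ∑ x' ∈ univ.filter (fun x' => ¬ b x' ∈ sq1), |G x'| * siteNorm v₀ := by
          refine sum_congr rfl fun x' hx' => ?_
          rw [hsupp _ (mem_filter.1 hx').2, zero_sub, siteNorm_neg]
      _ = (∑ x' ∈ univ.filter (fun x' => ¬ b x' ∈ sq1), |G x'|) * siteNorm v₀ := by rw [sum_mul]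
      _ ≤ (Real.exp (-(δ * R₁)) * c₀) * (tφ * q) :=
          mul_le_mul hC hv₀ (siteNorm_nonneg _) (by positivity)
      _ = Real.exp (-(δ * R₁)) * c₀ * tφ * q := by ring
  exact add_le_add hnear hfarS

/-- **(2.76) ON THE BOX, VALUES**: `(a_kG_k(□,0)Q_k^*□₁φ′)(x) = φ′(y) + O(p(L^kε))`, `x ∈ B^k(y)` — for the lineage's
`a_k(G_k(□)⊗1)Q_k^*` and a block field `φ′` supported in `□₁`: with `s(x′) = |x − x′|_∞/L^k`,
`|(a_k(G_k(□)⊗1)Q_k^*φ′)(x) − φ′(y)| ≤ a₊c₀(r₁ + r₂/δ₀)q + a₊c₀e^{−δ₀R₁}t_φq + (m²/(a_k+m²))t_φq`, the three terms of the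
decomposition (2.61) (`ζ ≡ 1`): the Lipschitz part by the restriction `|φ′(y′) − φ′(y)| ≤ q(r₁ + r₂s)`, the far part
(`□₁^c`, at distance `≥ R₁`) by `|φ′(y)| ≤ t_φq`, and the constant part by (2.75) `a_kG_k(□,0)Q_k^*1 = a_k/(a_k+m²)`; the
kernel decay is [B4] Theorem (1.10) at `A = 0` (`δ₀ = δG`, `c₀ = cG`, PROVED in the tree), `a_k ≤ a ≤ a₊`.
[cite: Balaban1982Higgs2, (2.76) p. 573, (2.61)–(2.63) p. 571] -/
theorem eq276_site {ℓ k : ℕ} (hℓ : 1 ≤ ℓ) (hk : 1 ≤ k) {amin aplus m2plus a m2 : ℝ} (ha : 0 < amin)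
    (e1' : amin ≤ a) (e2 : a ≤ aplus) (e3 : 0 ≤ m2) (e4 : m2 ≤ m2plus) {M : Fin (d + 1) → ℕ} (hM : ∀ i, 1 ≤ M i)
    (sq1 : Finset ↥(boxDom M)) (y : ↥(boxDom M)) (φ' : ↥(boxDom M) × ι → ℝ)
    (hsupp : ∀ y', y' ∉ sq1 → fld φ' y' = 0) {q tφ r₁ r₂ R₁ : ℝ} (hq : 0 ≤ q) (hr₁ : 0 ≤ r₁)
    (hr₂ : 0 ≤ r₂) (hbound : siteNorm (fld φ' y) ≤ tφ * q) (x : ↥(Box d ℓ k M))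
    (hlip : ∀ x' : ↥(Box d ℓ k M), blkSite d ℓ k M x' ∈ sq1 →
      siteNorm (fld φ' (blkSite d ℓ k M x') - fld φ' y)
        ≤ q * (r₁ + r₂ * (supNorm (x.1 - x'.1) / (((ℓ + 1) ^ k : ℕ) : ℝ))))
    (hfar : ∀ x' : ↥(Box d ℓ k M), blkSite d ℓ k M x' ∉ sq1 →
      R₁ ≤ supNorm (x.1 - x'.1) / (((ℓ + 1) ^ k : ℕ) : ℝ)) :
    siteNorm (fld (B1.aSeq a ((ℓ : ℝ) + 1) k • ((gk d ℓ k a m2 M ⊗ₖ (1 : Matrix ι ι ℝ))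
        *ᵥ ((avgOne ι d ℓ k M)ᵀ *ᵥ φ'))) x - fld φ' y)
      ≤ aplus * (cG d ℓ hℓ amin aplus m2plus ha * (r₁ + r₂ / δG d ℓ hℓ amin aplus m2plus ha)) * q
        + aplus * (Real.exp (-(δG d ℓ hℓ amin aplus m2plus ha * R₁)) * cG d ℓ hℓ amin aplus m2plus ha * tφ) * q
        + (m2 / (B1.aSeq a ((ℓ : ℝ) + 1) k + m2) * tφ) * q := by
  obtain ⟨hδ, hc, hroww⟩ := δG_spec d ℓ hℓ amin aplus m2plus ha
  have hrow := hroww k hk a m2 e1' e2 e3 e4 M hM x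
  have hL : (1 : ℝ) < (ℓ : ℝ) + 1 := by
    have : (1 : ℝ) ≤ (ℓ : ℝ) := by exact_mod_cast hℓ
    linarith
  have ha' : 0 < a := lt_of_lt_of_le ha e1'
  have hak : 0 < B1.aSeq a ((ℓ : ℝ) + 1) k := B1.aSeq_pos ha' hL hk
  have hakle : B1.aSeq a ((ℓ : ℝ) + 1) k ≤ aplus := (B1.aSeq_le ha' hL k hk).trans e2
  have hn : (0 : ℝ) < (((ℓ + 1) ^ k : ℕ) : ℝ) := by positivity
  have hs : ∀ x' : ↥(Box d ℓ k M), 0 ≤ supNorm (x.1 - x'.1) / (((ℓ + 1) ^ k : ℕ) : ℝ) := fun x' =>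
    div_nonneg (supNorm_nonneg _) hn.le
  have hpos : 0 < B1.aSeq a ((ℓ : ℝ) + 1) k + m2 := by positivity
  rw [fld_mainZero]
  have h1 : ∑ x', gk d ℓ k a m2 M x x' • (fld φ' (blkSite d ℓ k M x') - fld φ' y)
      = ∑ x', gk d ℓ k a m2 M x x' • fld φ' (blkSite d ℓ k M x') - (B1.aSeq a ((ℓ : ℝ) + 1) k + m2)⁻¹ • fld φ' y := by
    rw [← gk_rowsum hℓ hk ha' e3 hM x, Finset.sum_smul, ← Finset.sum_sub_distrib]
    exact sum_congr rfl fun x' _ => smul_sub _ _ _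
  have halg : B1.aSeq a ((ℓ : ℝ) + 1) k • ∑ x', gk d ℓ k a m2 M x x' • fld φ' (blkSite d ℓ k M x') - fld φ' y
      = B1.aSeq a ((ℓ : ℝ) + 1) k • ∑ x', gk d ℓ k a m2 M x x' • (fld φ' (blkSite d ℓ k M x') - fld φ' y)
        + (B1.aSeq a ((ℓ : ℝ) + 1) k * (B1.aSeq a ((ℓ : ℝ) + 1) k + m2)⁻¹ - 1) • fld φ' y := by
    rw [h1, smul_sub, smul_smul, sub_smul, one_smul]
    abel
  rw [halg]
  refine (siteNorm_add_le _ _).trans (add_le_add ?_ ?_)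
  · have hmain := recentered_sum_le hδ hs hrow sq1 (blkSite d ℓ k M) (fun y' => fld φ' y') (fld φ' y) hq hr₁ hr₂
      hsupp hbound hlip hfar
    rw [siteNorm_smul, abs_of_pos hak]
    calc B1.aSeq a ((ℓ : ℝ) + 1) k
          * siteNorm (∑ x', gk d ℓ k a m2 M x x' • (fld φ' (blkSite d ℓ k M x') - fld φ' y))
        ≤ aplus * (cG d ℓ hℓ amin aplus m2plus ha * (r₁ + r₂ / δG d ℓ hℓ amin aplus m2plus ha) * q
            + Real.exp (-(δG d ℓ hℓ amin aplus m2plus ha * R₁)) * cG d ℓ hℓ amin aplus m2plus ha * tφ * q) :=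
          mul_le_mul hakle hmain (siteNorm_nonneg _) (hak.le.trans hakle)
      _ = _ := by ring
  · rw [siteNorm_smul]
    have hkap : B1.aSeq a ((ℓ : ℝ) + 1) k * (B1.aSeq a ((ℓ : ℝ) + 1) k + m2)⁻¹ - 1
        = -(m2 / (B1.aSeq a ((ℓ : ℝ) + 1) k + m2)) := by
      field_simp
      ring
    rw [hkap, abs_neg, abs_of_nonneg (div_nonneg e3 hpos.le), mul_assoc]
    exact mul_le_mul_of_nonneg_left hbound (div_nonneg e3 hpos.le)

/-- **(2.77) ON THE BOX, THE MAIN TERM**: `|(a_k∂^η_μG_k(□,0)Q_k^*□₁φ′)(b)| ≤ a₊c₀′(r₁ + r₂/δ₀′)q + a₊c₀′e^{−δ₀′R₁}t_φq` for a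
bond `b = (x, x+e_μ)` of the box — «Using again the similar considerations as in the proof of Lemma 2.3 we get (2.66)»:
the decomposition (2.64) with `ζ ≡ 1` (the differenced kernel rows have ZERO sum by (2.75), so the constant term drops),
the restriction and the far part as in `eq276_site`; the kernel decay is [B4] Theorem (1.10) at `A = 0` for `∂^ηG_k(□)`
(`δ₀′ = δD`, `c₀′ = cD`, PROVED in the tree). [cite: Balaban1982Higgs2, (2.77) p. 573, p. 574 l. 1, (2.64) p. 571] -/
theorem eq277_site {ℓ k : ℕ} (hℓ : 1 ≤ ℓ) (hk : 1 ≤ k) {amin aplus m2plus a m2 : ℝ} (ha : 0 < amin)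
    (e1' : amin ≤ a) (e2 : a ≤ aplus) (e3 : 0 ≤ m2) (e4 : m2 ≤ m2plus) {M : Fin (d + 1) → ℕ} (hM : ∀ i, 1 ≤ M i)
    (sq1 : Finset ↥(boxDom M)) (y : ↥(boxDom M)) (φ' : ↥(boxDom M) × ι → ℝ)
    (hsupp : ∀ y', y' ∉ sq1 → fld φ' y' = 0) {q tφ r₁ r₂ R₁ : ℝ} (hq : 0 ≤ q) (hr₁ : 0 ≤ r₁)
    (hr₂ : 0 ≤ r₂) (hbound : siteNorm (fld φ' y) ≤ tφ * q) (μ : Fin (d + 1)) (x : ↥(Box d ℓ k M))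
    (hx : x.1 + e1 μ ∈ Box d ℓ k M)
    (hlip : ∀ x' : ↥(Box d ℓ k M), blkSite d ℓ k M x' ∈ sq1 →
      siteNorm (fld φ' (blkSite d ℓ k M x') - fld φ' y)
        ≤ q * (r₁ + r₂ * (supNorm (x.1 - x'.1) / (((ℓ + 1) ^ k : ℕ) : ℝ))))
    (hfar : ∀ x' : ↥(Box d ℓ k M), blkSite d ℓ k M x' ∉ sq1 →
      R₁ ≤ supNorm (x.1 - x'.1) / (((ℓ + 1) ^ k : ℕ) : ℝ)) :
    siteNorm (fld ((dk d ℓ k M μ ⊗ₖ (1 : Matrix ι ι ℝ)) *ᵥ (B1.aSeq a ((ℓ : ℝ) + 1) k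
        • ((gk d ℓ k a m2 M ⊗ₖ (1 : Matrix ι ι ℝ)) *ᵥ ((avgOne ι d ℓ k M)ᵀ *ᵥ φ')))) x)
      ≤ aplus * (cD d ℓ hℓ amin aplus m2plus ha * (r₁ + r₂ / δD d ℓ hℓ amin aplus m2plus ha)) * q
        + aplus * (Real.exp (-(δD d ℓ hℓ amin aplus m2plus ha * R₁)) * cD d ℓ hℓ amin aplus m2plus ha * tφ) * q := by
  obtain ⟨hδ, hc, hroww⟩ := δD_spec d ℓ hℓ amin aplus m2plus ha
  have hrow := hroww k hk a m2 e1' e2 e3 e4 M hM μ x hx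
  have hL : (1 : ℝ) < (ℓ : ℝ) + 1 := by
    have : (1 : ℝ) ≤ (ℓ : ℝ) := by exact_mod_cast hℓ
    linarith
  have ha' : 0 < a := lt_of_lt_of_le ha e1'
  have hak : 0 < B1.aSeq a ((ℓ : ℝ) + 1) k := B1.aSeq_pos ha' hL hk
  have hakle : B1.aSeq a ((ℓ : ℝ) + 1) k ≤ aplus := (B1.aSeq_le ha' hL k hk).trans e2
  have hn : (0 : ℝ) < (((ℓ + 1) ^ k : ℕ) : ℝ) := by positivity
  have hs : ∀ x' : ↥(Box d ℓ k M), 0 ≤ supNorm (x.1 - x'.1) / (((ℓ + 1) ^ k : ℕ) : ℝ) := fun x' =>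
    div_nonneg (supNorm_nonneg _) hn.le
  rw [fld_derivMainZero ℓ k a m2 M _ φ' μ hx]
  have hzero : ∑ x', (((ℓ + 1) ^ k : ℕ) : ℝ) * (gk d ℓ k a m2 M ⟨x.1 + e1 μ, hx⟩ x' - gk d ℓ k a m2 M x x') = 0 := by
    rw [← Finset.mul_sum, Finset.sum_sub_distrib, gk_rowsum hℓ hk ha' e3 hM, gk_rowsum hℓ hk ha' e3 hM, sub_self,
      mul_zero]
  rw [sum_smul_recenter univ _ (fun x' => fld φ' (blkSite d ℓ k M x')) (fld φ' y), hzero, zero_smul, add_zero,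
    siteNorm_smul, abs_of_pos hak]
  have hmain := recentered_sum_le hδ hs hrow sq1 (blkSite d ℓ k M) (fun y' => fld φ' y') (fld φ' y) hq hr₁ hr₂
    hsupp hbound hlip hfar
  calc B1.aSeq a ((ℓ : ℝ) + 1) k * siteNorm (∑ x', ((((ℓ + 1) ^ k : ℕ) : ℝ)
          * (gk d ℓ k a m2 M ⟨x.1 + e1 μ, hx⟩ x' - gk d ℓ k a m2 M x x')) • (fld φ' (blkSite d ℓ k M x') - fld φ' y))
      ≤ aplus * (cD d ℓ hℓ amin aplus m2plus ha * (r₁ + r₂ / δD d ℓ hℓ amin aplus m2plus ha) * q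
          + Real.exp (-(δD d ℓ hℓ amin aplus m2plus ha * R₁)) * cD d ℓ hℓ amin aplus m2plus ha * tφ * q) :=
        mul_le_mul hakle hmain (siteNorm_nonneg _) (hak.le.trans hakle)
    _ = _ := by ring

end Eq276

/-! ## §4 The objects of Lemma 2.4 on the lineage box: `□₁φ`, `g = a_kG_k(□,A^{(k)})Q_k^*(A^{(k)})□₁φ`, its kernel blocks,
the outer field `φ^{(k)}` of (2.56) in kernel form, and the transporters `U(A^{(k)}(Γ^{(k)}_{x,y}))` -/

section Objects

variable {d : ℕ}

/-- **`□₁φ`** as a field on `□₂ × ι`: `φ` on the unit sites of `□₁`, `0` on `□₂ ∖ □₁`.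
[cite: Balaban1982Higgs2, p. 572 «□₁, □₂ as the sums of large blocks … distant from the point y less than 2r(L^kε),
4r(L^kε)»] -/
def boxOneField {M : Fin (d + 1) → ℕ} (sq1 : Finset ↥(boxDom M)) (φ : ↥(boxDom M) → ι → ℝ) :
    ↥(boxDom M) × ι → ℝ :=
  fun p => if p.1 ∈ sq1 then φ p.1 p.2 else 0

omit [Fintype ι] [DecidableEq ι] in
/-- `□₁φ = φ` on `□₁`. [cite: Balaban1982Higgs2, p. 572] -/
theorem fld_boxOneField_of_mem {M : Fin (d + 1) → ℕ} {sq1 : Finset ↥(boxDom M)} (φ : ↥(boxDom M) → ι → ℝ)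
    {y' : ↥(boxDom M)} (h : y' ∈ sq1) : fld (boxOneField sq1 φ) y' = φ y' := by
  funext i; simp [boxOneField, h]

omit [Fintype ι] [DecidableEq ι] in
/-- `□₁φ = 0` off `□₁`. [cite: Balaban1982Higgs2, p. 572] -/
theorem fld_boxOneField_of_not_mem {M : Fin (d + 1) → ℕ} {sq1 : Finset ↥(boxDom M)} (φ : ↥(boxDom M) → ι → ℝ)
    {y' : ↥(boxDom M)} (h : y' ∉ sq1) : fld (boxOneField sq1 φ) y' = 0 := by
  funext i; simp [boxOneField, h]

variable (d) in
/-- **`g = a_kG_k(□,Ã)Q_k^*(Ã)Ψ`** — the localized field of (2.67)/(2.68) for the lineage's operators (`Ã = A₀ + A'`).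
[cite: Balaban1982Higgs2, (2.67)–(2.68) p. 572] -/
abbrev gVec (F : OrthFlow ι) (κ : ℝ) (ℓ k : ℕ) (a m2 : ℝ) (M : Fin (d + 1) → ℕ)
    (emb : ↥(boxDom M) → ↥(Box d ℓ k M)) (Γ : ↥(boxDom M) → ↥(Box d ℓ k M) → List ↥(Box d ℓ k M))
    (A₀ : Fin (d + 1) → ℝ) (A' : ↥(Box d ℓ k M) → ↥(Box d ℓ k M) → ℝ) (Ψ : ↥(boxDom M) × ι → ℝ) :
    ↥(Box d ℓ k M) × ι → ℝ :=
  B1.aSeq a ((ℓ : ℝ) + 1) k • (greenA d F κ ℓ k a m2 M emb Γ (constBond A₀ Subtype.val + A')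
    *ᵥ ((avgA d F κ ℓ k M emb Γ (constBond A₀ Subtype.val + A'))ᵀ *ᵥ Ψ))

variable (d) in
/-- **THE KERNEL BLOCKS `a_k(G_k(□,Ã)Q_k^*(Ã))(x,y′)`** (`ι × ι` matrices) of the localized propagator.
[cite: Balaban1982Higgs2, (2.58) p. 570, (2.67) p. 572] -/
def kerBox (F : OrthFlow ι) (κ : ℝ) (ℓ k : ℕ) (a m2 : ℝ) (M : Fin (d + 1) → ℕ)
    (emb : ↥(boxDom M) → ↥(Box d ℓ k M)) (Γ : ↥(boxDom M) → ↥(Box d ℓ k M) → List ↥(Box d ℓ k M))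
    (A₀ : Fin (d + 1) → ℝ) (A' : ↥(Box d ℓ k M) → ↥(Box d ℓ k M) → ℝ) (x : ↥(Box d ℓ k M)) (y' : ↥(boxDom M)) :
    Matrix ι ι ℝ :=
  Matrix.of fun i j => (B1.aSeq a ((ℓ : ℝ) + 1) k • (greenA d F κ ℓ k a m2 M emb Γ (constBond A₀ Subtype.val + A')
    * (avgA d F κ ℓ k M emb Γ (constBond A₀ Subtype.val + A'))ᵀ)) (x, i) (y', j)

variable (d) in
/-- **THE KERNEL BLOCKS `a_k(D^η_{Ã,μ}G_k(□,Ã)Q_k^*(Ã))(b,y′)`**, `b = (x, x + e_μ)`.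
[cite: Balaban1982Higgs2, (2.58) p. 570, (2.67) p. 572] -/
def dkerBox (F : OrthFlow ι) (κ : ℝ) (ℓ k : ℕ) (a m2 : ℝ) (M : Fin (d + 1) → ℕ)
    (emb : ↥(boxDom M) → ↥(Box d ℓ k M)) (Γ : ↥(boxDom M) → ↥(Box d ℓ k M) → List ↥(Box d ℓ k M))
    (A₀ : Fin (d + 1) → ℝ) (A' : ↥(Box d ℓ k M) → ↥(Box d ℓ k M) → ℝ) (μ : Fin (d + 1)) (x : ↥(Box d ℓ k M))
    (y' : ↥(boxDom M)) : Matrix ι ι ℝ :=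
  Matrix.of fun i j => (derivA d F κ ℓ k M (constBond A₀ Subtype.val + A') μ
    * (B1.aSeq a ((ℓ : ℝ) + 1) k • (greenA d F κ ℓ k a m2 M emb Γ (constBond A₀ Subtype.val + A')
      * (avgA d F κ ℓ k M emb Γ (constBond A₀ Subtype.val + A'))ᵀ))) (x, i) (y', j)

/-- `g(x) = Σ_{y′} a_k(G_kQ_k^*)(x,y′)Ψ(y′)`. [cite: Balaban1982Higgs2, (2.67) p. 572] -/
theorem fld_gVec (F : OrthFlow ι) (κ : ℝ) (ℓ k : ℕ) (a m2 : ℝ) (M : Fin (d + 1) → ℕ)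
    (emb : ↥(boxDom M) → ↥(Box d ℓ k M)) (Γ : ↥(boxDom M) → ↥(Box d ℓ k M) → List ↥(Box d ℓ k M))
    (A₀ : Fin (d + 1) → ℝ) (A' : ↥(Box d ℓ k M) → ↥(Box d ℓ k M) → ℝ) (Ψ : ↥(boxDom M) × ι → ℝ)
    (x : ↥(Box d ℓ k M)) :
    fld (gVec d F κ ℓ k a m2 M emb Γ A₀ A' Ψ) x = ∑ y', kerBox d F κ ℓ k a m2 M emb Γ A₀ A' x y' *ᵥ fld Ψ y' := by
  dsimp only [gVec, kerBox]
  rw [mulVec_mulVec, ← smul_mulVec, fld_mulVec_blocks]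

/-- `(D^η_{Ã,μ}g)(x) = Σ_{y′} a_k(D^η_{Ã,μ}G_kQ_k^*)(x,y′)Ψ(y′)`. [cite: Balaban1982Higgs2, (2.67) p. 572] -/
theorem fld_deriv_gVec (F : OrthFlow ι) (κ : ℝ) (ℓ k : ℕ) (a m2 : ℝ) (M : Fin (d + 1) → ℕ)
    (emb : ↥(boxDom M) → ↥(Box d ℓ k M)) (Γ : ↥(boxDom M) → ↥(Box d ℓ k M) → List ↥(Box d ℓ k M))
    (A₀ : Fin (d + 1) → ℝ) (A' : ↥(Box d ℓ k M) → ↥(Box d ℓ k M) → ℝ) (Ψ : ↥(boxDom M) × ι → ℝ)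
    (μ : Fin (d + 1)) (x : ↥(Box d ℓ k M)) :
    fld (derivA d F κ ℓ k M (constBond A₀ Subtype.val + A') μ *ᵥ gVec d F κ ℓ k a m2 M emb Γ A₀ A' Ψ) x
      = ∑ y', dkerBox d F κ ℓ k a m2 M emb Γ A₀ A' μ x y' *ᵥ fld Ψ y' := by
  dsimp only [gVec, dkerBox]
  rw [mulVec_mulVec, ← smul_mulVec, mulVec_mulVec, fld_mulVec_blocks]

variable (d) in
/-- the DIFFERENCED OUTER KERNEL ROWS along a bond `b = (x, x+e_μ)` of the box:
`(D^η_{A,μ}K)(b,y′) = η⁻¹(U(A_b)K(x+e_μ,y′) − K(x,y′))` — so that `(D^η_{A,μ}Σ_{y′}K(·,y′)φ(y′))(b) = Σ_{y′}(D^η_{A,μ}K)(b,y′)φ(y′)`.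
[cite: Balaban1983RegularityDecay, (1.3) p. 572; Balaban1982Higgs2, (2.58) p. 570] -/
def dKer {Yo : Type*} (F : OrthFlow ι) (κ : ℝ) (ℓ k : ℕ) (M : Fin (d + 1) → ℕ)
    (A : ↥(Box d ℓ k M) → ↥(Box d ℓ k M) → ℝ) (K : ↥(Box d ℓ k M) → Yo → Matrix ι ι ℝ) (μ : Fin (d + 1))
    (x : ↥(Box d ℓ k M)) (h : x.1 + e1 μ ∈ Box d ℓ k M) (y' : Yo) : Matrix ι ι ℝ :=
  ((((ℓ + 1) ^ k : ℕ) : ℝ)) • (fieldLink F κ A x ⟨x.1 + e1 μ, h⟩ * K ⟨x.1 + e1 μ, h⟩ y' - K x y')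

omit [DecidableEq ι] in
/-- `Σ_{y′}(D^η_{A,μ}K)(b,y′)φ(y′) = η⁻¹(U(A_b)(Σ K(x+e_μ,·)φ) − Σ K(x,·)φ)`. [cite: Balaban1983RegularityDecay, (1.3) p. 572] -/
theorem sum_dKer_mulVec [DecidableEq ι] {Yo : Type*} (F : OrthFlow ι) (κ : ℝ) (ℓ k : ℕ) (M : Fin (d + 1) → ℕ)
    (A : ↥(Box d ℓ k M) → ↥(Box d ℓ k M) → ℝ) (K : ↥(Box d ℓ k M) → Yo → Matrix ι ι ℝ) (μ : Fin (d + 1))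
    (x : ↥(Box d ℓ k M)) (h : x.1 + e1 μ ∈ Box d ℓ k M) (T : Finset Yo) (φ : Yo → ι → ℝ) :
    ∑ y' ∈ T, dKer d F κ ℓ k M A K μ x h y' *ᵥ φ y'
      = ((((ℓ + 1) ^ k : ℕ) : ℝ)) • (fieldLink F κ A x ⟨x.1 + e1 μ, h⟩ *ᵥ (∑ y' ∈ T, K ⟨x.1 + e1 μ, h⟩ y' *ᵥ φ y')
          - ∑ y' ∈ T, K x y' *ᵥ φ y') := by
  simp only [dKer, smul_mulVec, sub_mulVec, ← mulVec_mulVec, Finset.smul_sum, Finset.sum_sub_distrib, mulVec_sum,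
    smul_sub]

/-- **THE CONSTANT-FIELD TRANSPORTER ALONG A BLOCK CONTOUR IS A PURE GAUGE**: `U(A₀(Γ^{(k)}_{y,x})) = 𝒢(emb y)𝒢(x)ᵀ`
for `x ∈ B^k(y)` («A₀(Γ_{y,y′} ∪ Γ^{(k)}_{y′,x′} ∪ Γ_{x′,y}) = 0», path independence).
[cite: Balaban1982Higgs2, (2.71)–(2.72) p. 573] -/
theorem contourTrans_constBond (F : OrthFlow ι) (κ : ℝ) (ℓ k : ℕ) (M : Fin (d + 1) → ℕ)
    {emb : ↥(boxDom M) → ↥(Box d ℓ k M)} {Γ : ↥(boxDom M) → ↥(Box d ℓ k M) → List ↥(Box d ℓ k M)}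
    (hend : ∀ y x, blkWt ((ℓ + 1) ^ k) M (fun i => (ℓ + 1) ^ k * M i) y x ≠ 0 → pathEnd (emb y) (Γ y x) = x)
    (A₀ : Fin (d + 1) → ℝ) {y : ↥(boxDom M)} {x : ↥(Box d ℓ k M)} (hx : blkSite d ℓ k M x = y) :
    contourTrans (fieldLink F κ (constBond A₀ Subtype.val)) emb Γ y x
      = gaugeU d F κ ℓ k M A₀ (emb y) * (gaugeU d F κ ℓ k M A₀ x)ᵀ := by
  have hq : blkWt ((ℓ + 1) ^ k) M (fun i => (ℓ + 1) ^ k * M i) y x ≠ 0 := by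
    rw [blkWt_eq_ite, if_pos hx.symm]; exact one_ne_zero
  dsimp only [contourTrans, gaugeU]
  rw [fieldLink_constBond, transport_gauge (F.isGauge _), transport_one, Matrix.mul_one, hend y x hq]

/-- **`(Q_k^*(Ã)Ψ)(x) = U(Ã(Γ^{(k)}_{y,x}))ᵀΨ(y)`**, `x ∈ B^k(y)`: the two right-hand sides of (2.65) carry the same
transporter (weight-1 adjoint block average). [cite: Balaban1982Higgs2, (2.65) p. 572] -/
theorem fld_avgA_transpose (F : OrthFlow ι) (κ : ℝ) (ℓ k : ℕ) (M : Fin (d + 1) → ℕ)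
    (emb : ↥(boxDom M) → ↥(Box d ℓ k M)) (Γ : ↥(boxDom M) → ↥(Box d ℓ k M) → List ↥(Box d ℓ k M))
    (A : ↥(Box d ℓ k M) → ↥(Box d ℓ k M) → ℝ) (Ψ : ↥(boxDom M) × ι → ℝ) (x : ↥(Box d ℓ k M)) :
    fld ((avgA d F κ ℓ k M emb Γ A)ᵀ *ᵥ Ψ) x
      = (contourTrans (fieldLink F κ A) emb Γ (blkSite d ℓ k M x) x)ᵀ *ᵥ fld Ψ (blkSite d ℓ k M x) := by
  dsimp only [avgA]
  rw [fld_avgOp_transpose_mulVec, Finset.sum_eq_single (blkSite d ℓ k M x)]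
  · rw [blkWt_eq_ite, if_pos rfl, one_smul]
  · intro y' _ hy'
    rw [blkWt_eq_ite, if_neg hy', zero_smul]
  · intro h; exact absurd (Finset.mem_univ _) h

end Objects

/-! ## §3b The derivative of the (2.68) remainder, up to its divergence-form cross term -/

section Eq268D

variable {d : ℕ}

/-- **THE DERIVATIVE OF THE (2.68) REMAINDER, SITEWISE, UP TO THE PIECE `D^η_{A₀}G_k(□,A₀)D^{η*}_{A₀}F_{1,k}g`** («and
similarly for the derivative»): with `g`, `main` as in `B2Eq268GaugeAway.remainder268_sup`, uniformly on the window and in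
`κ`: `|(D^η_{A₀,ν}(g − main))(x)| ≤ c·a_kℓ₁τ‖Ψ‖_∞ + c(d+1)ℓ₁θΣ_μ‖D^η_{A₀,μ}g‖_∞ + c((d+1)ℓ₁²θ² + a_kℓ₁τ(2+ℓ₁τ))‖g‖_∞
+ |(D^η_{A₀,ν}G_k(□,A₀)C g)(x)|`, `C` the divergence-form cross term of [B4] (2.24)/(2.32) (`B4Lower18Regular.crossOp`) —
every other piece by the derivative clause `‖D^η_{A₀,ν}G_k(□,A₀)Φ‖_∞ ≤ c‖Φ‖_∞` of (2.17) at constant `A₀` and the sup-row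
site lemmas of `B4Lemma22PertVSup`; the `C`-piece is left as is (cell GAPS.md `G-B2-Lem24-D`).
[cite: Balaban1982Higgs2, (2.68) p. 572 «and similarly for the derivative»; Balaban1983RegularityDecay, (2.24) p. 580,
(2.32) p. 581, Lemma 2.2 (2.17) p. 578] -/
theorem remainder268_deriv_site (F : OrthFlow ι) {ℓ₁ : ℝ} (hℓ₁ : 0 ≤ ℓ₁)
    (hLip : ∀ t (v : ι → ℝ), ((F.U t - 1) *ᵥ v) ⬝ᵥ ((F.U t - 1) *ᵥ v) ≤ (ℓ₁ * t) ^ 2 * (v ⬝ᵥ v))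
    (d ℓ : ℕ) (hℓ : 1 ≤ ℓ) (amin aplus m2plus : ℝ) (ha : 0 < amin) :
    ∃ c : ℝ, 0 < c ∧ ∀ (κ : ℝ) (k : ℕ), 1 ≤ k → ∀ (a m2 : ℝ), amin ≤ a → a ≤ aplus → 0 ≤ m2 → m2 ≤ m2plus →
      ∀ (M : Fin (d + 1) → ℕ), (∀ i, 1 ≤ M i) →
      ∀ (emb : ↥(boxDom M) → ↥(Box d ℓ k M)) (Γ : ↥(boxDom M) → ↥(Box d ℓ k M) → List ↥(Box d ℓ k M)),
        (∀ y x, blkWt ((ℓ + 1) ^ k) M (fun i => (ℓ + 1) ^ k * M i) y x ≠ 0 → pathEnd (emb y) (Γ y x) = x) →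
      ∀ (A₀ : Fin (d + 1) → ℝ) (A' : ↥(Box d ℓ k M) → ↥(Box d ℓ k M) → ℝ) (θ τ : ℝ),
        IsUnit (opA d F κ ℓ k a m2 M emb Γ (constBond A₀ Subtype.val + A')).det →
        0 ≤ θ → (∀ x y : ↥(Box d ℓ k M), y.1 ∈ nbrs x.1 → |κ * A' x y| ≤ θ / ((ℓ + 1) ^ k : ℕ)) →
        0 ≤ τ → (∀ y x, blkWt ((ℓ + 1) ^ k) M (fun i => (ℓ + 1) ^ k * M i) y x ≠ 0 →
          |κ * lsum A' (emb y) (Γ y x)| ≤ τ) →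
        ∀ (Ψ : ↥(boxDom M) × ι → ℝ) (ν : Fin (d + 1)) (x : ↥(Box d ℓ k M)),
          siteNorm (fld (derivA0 d F κ ℓ k M A₀ ν *ᵥ (gVec d F κ ℓ k a m2 M emb Γ A₀ A' Ψ
              - B1.aSeq a ((ℓ : ℝ) + 1) k • (greenA0 d F κ ℓ k a m2 M emb Γ A₀
                *ᵥ ((avgA d F κ ℓ k M emb Γ (constBond A₀ Subtype.val))ᵀ *ᵥ Ψ)))) x)
            ≤ c * (B1.aSeq a ((ℓ : ℝ) + 1) k * (ℓ₁ * τ)) * supN Ψ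
              + c * (((d : ℝ) + 1) * ℓ₁ * θ)
                * ∑ μ, supN (derivA0 d F κ ℓ k M A₀ μ *ᵥ gVec d F κ ℓ k a m2 M emb Γ A₀ A' Ψ)
              + c * (((d : ℝ) + 1) * ℓ₁ ^ 2 * θ ^ 2 + B1.aSeq a ((ℓ : ℝ) + 1) k * (ℓ₁ * τ * (2 + ℓ₁ * τ)))
                * supN (gVec d F κ ℓ k a m2 M emb Γ A₀ A' Ψ)
              + siteNorm (fld (derivA0 d F κ ℓ k M A₀ ν *ᵥ (greenA0 d F κ ℓ k a m2 M emb Γ A₀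
                  *ᵥ (B4Lower18Regular.crossOp (boxWt ((ℓ + 1) ^ k) fun i => (ℓ + 1) ^ k * M i)
                      (fieldLink F κ (constBond A₀ Subtype.val)) (B4Lower18Regular.pertE (fieldLink F κ A'))
                    *ᵥ gVec d F κ ℓ k a m2 M emb Γ A₀ A' Ψ))) x) := by
  obtain ⟨c, hc, h⟩ := const_box_unif F d ℓ hℓ amin aplus m2plus ha
  refine ⟨c, hc, ?_⟩
  intro κ k hk a m2 e1' e2 e3 e4 M hM emb Γ hend A₀ A' θ τ hunit hθ hA' hτ0 hτ Ψ ν x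
  obtain ⟨-, hD, -, -⟩ := h κ k hk a m2 e1' e2 e3 e4 M hM emb Γ hend A₀
  have hc0 : 0 ≤ c := hc.le
  have hn : 1 ≤ (ℓ + 1) ^ k := Nat.one_le_pow _ _ (Nat.succ_pos ℓ)
  have hL : (1 : ℝ) < (ℓ : ℝ) + 1 := by
    have : (1 : ℝ) ≤ (ℓ : ℝ) := by exact_mod_cast hℓ
    linarith
  have hak : 0 < B1.aSeq a ((ℓ : ℝ) + 1) k := B1.aSeq_pos (lt_of_lt_of_le ha e1') hL hk
  have hanti := constBond_antisymm A₀ (Subtype.val : ↥(Box d ℓ k M) → (Fin (d + 1) → ℤ))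
  have hexp := expansion268 F κ hℓ hk (lt_of_lt_of_le ha e1') e3 hM hend A₀ hunit (B1.aSeq a ((ℓ : ℝ) + 1) k) Ψ
  dsimp only [gVec]
  set ak := B1.aSeq a ((ℓ : ℝ) + 1) k with hakdef
  set G := greenA d F κ ℓ k a m2 M emb Γ (constBond A₀ Subtype.val + A') with hGdef
  set G₀ := greenA0 d F κ ℓ k a m2 M emb Γ A₀ with hG₀def
  set D := derivA0 d F κ ℓ k M A₀ ν with hDdef
  generalize hgdef : ak • (G *ᵥ ((avgA d F κ ℓ k M emb Γ (constBond A₀ Subtype.val + A'))ᵀ *ᵥ Ψ)) = g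
    at hexp ⊢
  have hS0 : 0 ≤ ∑ μ, supN (derivA0 d F κ ℓ k M A₀ μ *ᵥ g) := sum_nonneg fun μ _ => supN_nonneg _
  have hg0 : 0 ≤ supN g := supN_nonneg g
  have hΨ0 : 0 ≤ supN Ψ := supN_nonneg Ψ
  set C := B4Lower18Regular.crossOp (boxWt ((ℓ + 1) ^ k) fun i => (ℓ + 1) ^ k * M i)
    (fieldLink F κ (constBond A₀ Subtype.val)) (B4Lower18Regular.pertE (fieldLink F κ A')) with hCdef
  set Qd := B4Lower18Regular.quadOp (boxWt ((ℓ + 1) ^ k) fun i => (ℓ + 1) ^ k * M i)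
    (B4Lower18Regular.pertE (fieldLink F κ A')) with hQddef
  set P := pertF2 d F κ ℓ k M emb Γ A₀ A' with hPdef
  set Q₀ := avgA d F κ ℓ k M emb Γ (constBond A₀ Subtype.val) with hQ₀def
  set aT := (ak * ((((ℓ + 1) ^ k : ℕ) : ℝ) ^ (d + 1))⁻¹) • (Pᵀ * Q₀ + Q₀ᵀ * P + Pᵀ * P) with haTdef
  have hV : pertV d F κ ℓ k a M emb Γ A₀ A' = -(C + Cᵀ + Qd + aT) := rfl
  -- the pieces, in `‖·‖_∞`, through the derivative clause `hD`
  have hEF : supN (D *ᵥ (ak • (G₀ *ᵥ (Pᵀ *ᵥ Ψ)))) ≤ c * (ak * (ℓ₁ * τ)) * supN Ψ := by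
    rw [mulVec_smul]
    refine (supN_smul_le _ _).trans ?_
    rw [abs_of_pos hak]
    have h1 : supN (D *ᵥ (G₀ *ᵥ (Pᵀ *ᵥ Ψ))) ≤ c * supN (Pᵀ *ᵥ Ψ) := hD ν _
    have h2 : supN (Pᵀ *ᵥ Ψ) ≤ ℓ₁ * τ * supN Ψ :=
      supN_le (mul_nonneg (mul_nonneg hℓ₁ hτ0) hΨ0) fun x =>
        B4Lemma22PertVSup.pertFT_site F κ M emb Γ (constBond A₀ Subtype.val) A' hℓ₁ hLip hτ0 hτ Ψ x
    have h3 : c * supN (Pᵀ *ᵥ Ψ) ≤ c * (ℓ₁ * τ * supN Ψ) := mul_le_mul_of_nonneg_left h2 hc0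
    nlinarith [h1.trans h3, hak.le]
  have hCT : supN (D *ᵥ (G₀ *ᵥ (Cᵀ *ᵥ g)))
      ≤ c * (((d : ℝ) + 1) * ℓ₁ * θ) * ∑ μ, supN (derivA0 d F κ ℓ k M A₀ μ *ᵥ g) := by
    have h1 : supN (D *ᵥ (G₀ *ᵥ (Cᵀ *ᵥ g))) ≤ c * supN (Cᵀ *ᵥ g) := hD ν _
    have h2 : supN (Cᵀ *ᵥ g) ≤ ((d : ℝ) + 1) * ℓ₁ * θ * ∑ μ, supN (derivA0 d F κ ℓ k M A₀ μ *ᵥ g) :=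
      supN_le (mul_nonneg (by positivity) hS0) fun z =>
        B4Lemma22PertVSup.crossT_site F hℓ₁ hLip κ hn (fun i => (ℓ + 1) ^ k * M i) (constBond A₀ Subtype.val)
          hanti hθ hA' g z
    calc supN (D *ᵥ (G₀ *ᵥ (Cᵀ *ᵥ g))) ≤ c * supN (Cᵀ *ᵥ g) := h1
      _ ≤ c * (((d : ℝ) + 1) * ℓ₁ * θ * ∑ μ, supN (derivA0 d F κ ℓ k M A₀ μ *ᵥ g)) :=
          mul_le_mul_of_nonneg_left h2 hc0
      _ = _ := by ring
  have hQd : supN (D *ᵥ (G₀ *ᵥ (Qd *ᵥ g))) ≤ c * (((d : ℝ) + 1) * ℓ₁ ^ 2 * θ ^ 2) * supN g := by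
    have h1 : supN (D *ᵥ (G₀ *ᵥ (Qd *ᵥ g))) ≤ c * supN (Qd *ᵥ g) := hD ν _
    have h2 : supN (Qd *ᵥ g) ≤ ((d : ℝ) + 1) * ℓ₁ ^ 2 * θ ^ 2 * supN g :=
      supN_le (mul_nonneg (by positivity) hg0) fun z =>
        B4Lemma22PertVSup.quad_site F hℓ₁ hLip κ hn (fun i => (ℓ + 1) ^ k * M i) hθ hA' g z
    calc supN (D *ᵥ (G₀ *ᵥ (Qd *ᵥ g))) ≤ c * supN (Qd *ᵥ g) := h1
      _ ≤ c * (((d : ℝ) + 1) * ℓ₁ ^ 2 * θ ^ 2 * supN g) := mul_le_mul_of_nonneg_left h2 hc0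
      _ = _ := by ring
  have haT : supN (D *ᵥ (G₀ *ᵥ (aT *ᵥ g))) ≤ c * (ak * (ℓ₁ * τ * (2 + ℓ₁ * τ))) * supN g := by
    have h1 : supN (D *ᵥ (G₀ *ᵥ (aT *ᵥ g))) ≤ c * supN (aT *ᵥ g) := hD ν _
    have h2 : supN (aT *ᵥ g) ≤ ak * (ℓ₁ * τ * (2 + ℓ₁ * τ)) * supN g :=
      B4Lemma22PertVSup.aterm_supN_le' F κ M emb Γ (constBond A₀ Subtype.val) A' hℓ₁ hLip hn hτ0 hτ hak.le g
    calc supN (D *ᵥ (G₀ *ᵥ (aT *ᵥ g))) ≤ c * supN (aT *ᵥ g) := h1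
      _ ≤ c * (ak * (ℓ₁ * τ * (2 + ℓ₁ * τ)) * supN g) := mul_le_mul_of_nonneg_left h2 hc0
      _ = _ := by ring
  -- assembly at the site `x`
  have hid : g - ak • (G₀ *ᵥ (Q₀ᵀ *ᵥ Ψ)) = ak • (G₀ *ᵥ (Pᵀ *ᵥ Ψ)) + G₀ *ᵥ (pertV d F κ ℓ k a M emb Γ A₀ A' *ᵥ g) := by
    conv_lhs => rw [hexp]
    abel
  have hVg : D *ᵥ (G₀ *ᵥ (pertV d F κ ℓ k a M emb Γ A₀ A' *ᵥ g))
      = -(D *ᵥ (G₀ *ᵥ (C *ᵥ g)) + D *ᵥ (G₀ *ᵥ (Cᵀ *ᵥ g)) + D *ᵥ (G₀ *ᵥ (Qd *ᵥ g))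
          + D *ᵥ (G₀ *ᵥ (aT *ᵥ g))) := by
    rw [hV, neg_mulVec, mulVec_neg, mulVec_neg, add_mulVec, add_mulVec, add_mulVec, mulVec_add, mulVec_add,
      mulVec_add, mulVec_add, mulVec_add, mulVec_add]
  rw [hid, mulVec_add, hVg, B4Lemma22Reduce231.fld_add]
  refine (siteNorm_add_le _ _).trans ?_
  have hA1 : siteNorm (fld (D *ᵥ (ak • (G₀ *ᵥ (Pᵀ *ᵥ Ψ)))) x) ≤ c * (ak * (ℓ₁ * τ)) * supN Ψ :=
    (le_supN _ x).trans hEF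
  have hA2 : siteNorm (fld (-(D *ᵥ (G₀ *ᵥ (C *ᵥ g)) + D *ᵥ (G₀ *ᵥ (Cᵀ *ᵥ g)) + D *ᵥ (G₀ *ᵥ (Qd *ᵥ g))
        + D *ᵥ (G₀ *ᵥ (aT *ᵥ g)))) x)
      ≤ siteNorm (fld (D *ᵥ (G₀ *ᵥ (C *ᵥ g))) x)
        + c * (((d : ℝ) + 1) * ℓ₁ * θ) * ∑ μ, supN (derivA0 d F κ ℓ k M A₀ μ *ᵥ g)
        + c * (((d : ℝ) + 1) * ℓ₁ ^ 2 * θ ^ 2) * supN g + c * (ak * (ℓ₁ * τ * (2 + ℓ₁ * τ))) * supN g := by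
    have hneg : ∀ u : ↥(Box d ℓ k M) × ι → ℝ, fld (-u) x = -fld u x := fun u => rfl
    rw [hneg, siteNorm_neg, B4Lemma22Reduce231.fld_add, B4Lemma22Reduce231.fld_add, B4Lemma22Reduce231.fld_add]
    refine (siteNorm_add_le _ _).trans (add_le_add ((siteNorm_add_le _ _).trans (add_le_add
      ((siteNorm_add_le _ _).trans (add_le_add le_rfl ((le_supN _ x).trans hCT))) ((le_supN _ x).trans hQd)))
      ((le_supN _ x).trans haT))
  refine (add_le_add hA1 hA2).trans (le_of_eq ?_)
  ring

end Eq268D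

/-! ## §5 The model family of Lemma 2.4 -/

section ModelDef

variable (ι)

/-- THE FIXED DATA OF THE FAMILY (chosen before the instance, so that the `O(·)` of (2.65)–(2.66) is uniform): the block
size `L = ℓ + 1`, [B4]'s abelian flow `U = F.U` with its Lipschitz modulus `ℓ₁` (`|U(t) − 1| ≤ ℓ₁|t|`), the window
`a ∈ [amin, aplus]`, `m² ∈ [0, m2plus]` of the running coefficients; the constants `c₀, δ₀` of Proposition 2.2 (2.58) on
`Ω` (`cO`, `δO`) with the lattice-sum bound `SO`; the constant of Proposition I.2.2 for `(□, A^{(k)})` (`cI`); the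
integrated restriction constants `r₁, r₂`; and the scale constants `K₁ … K₅, Kθ, Kτ, KD` bounding the instance's
«O((L^kε)^{κ₀})»/«O(p(L^kε))» products (see `Model`). [cite: Balaban1982Higgs2, Lemma 2.4 p. 572, Proposition 2.2 (2.58)
p. 570; Balaban1983RegularityDecay, (1.2) p. 572] -/
structure Frame (d : ℕ) where
  ℓ : ℕ
  hℓ : 1 ≤ ℓ
  F : OrthFlow ι
  ℓ₁ : ℝ
  hℓ₁ : 0 ≤ ℓ₁
  hLip : ∀ t (v : ι → ℝ), ((F.U t - 1) *ᵥ v) ⬝ᵥ ((F.U t - 1) *ᵥ v) ≤ (ℓ₁ * t) ^ 2 * (v ⬝ᵥ v)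
  amin : ℝ
  aplus : ℝ
  m2plus : ℝ
  ha : 0 < amin
  hwin : amin ≤ aplus
  cO : ℝ
  δO : ℝ
  SO : ℝ
  cI : ℝ
  r₁ : ℝ
  r₂ : ℝ
  K₁ : ℝ
  K₂ : ℝ
  K₃ : ℝ
  K₄ : ℝ
  K₅ : ℝ
  Kθ : ℝ
  Kτ : ℝ
  KD : ℝ
  cO_nonneg : 0 ≤ cO
  δO_pos : 0 < δO
  SO_nonneg : 0 ≤ SO
  cI_nonneg : 0 ≤ cI
  r₁_nonneg : 0 ≤ r₁
  r₂_nonneg : 0 ≤ r₂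
  K₁_nonneg : 0 ≤ K₁
  K₂_nonneg : 0 ≤ K₂
  K₃_nonneg : 0 ≤ K₃
  K₄_nonneg : 0 ≤ K₄
  K₅_nonneg : 0 ≤ K₅
  Kθ_nonneg : 0 ≤ Kθ
  Kτ_nonneg : 0 ≤ Kτ
  KD_nonneg : 0 ≤ KD

variable {ι}

namespace Frame

variable {d : ℕ} (fr : Frame ι d)

/-- `a₊ > 0` (the window is nonempty). [cite: Balaban1982Higgs2, Lemma 2.4 p. 572] -/
theorem aplus_pos : 0 < fr.aplus := lt_of_lt_of_le fr.ha fr.hwin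

/-- `δ₀` of [B4] Theorem (1.10) at `A = 0`, values (`δG` of the frame's window). [cite: Balaban1983RegularityDecay, (1.10) p. 573] -/
abbrev dG : ℝ := δG d fr.ℓ fr.hℓ fr.amin fr.aplus fr.m2plus fr.ha
/-- `c₀` of [B4] Theorem (1.10) at `A = 0`, values. [cite: Balaban1983RegularityDecay, (1.10) p. 573] -/
abbrev kG : ℝ := cG d fr.ℓ fr.hℓ fr.amin fr.aplus fr.m2plus fr.ha
/-- `δ₀` of [B4] Theorem (1.10) at `A = 0`, derivatives. [cite: Balaban1983RegularityDecay, (1.10) p. 573] -/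
abbrev dD : ℝ := δD d fr.ℓ fr.hℓ fr.amin fr.aplus fr.m2plus fr.ha
/-- `c₀` of [B4] Theorem (1.10) at `A = 0`, derivatives. [cite: Balaban1983RegularityDecay, (1.10) p. 573] -/
abbrev kD : ℝ := cD d fr.ℓ fr.hℓ fr.amin fr.aplus fr.m2plus fr.ha
end Frame

/-- **ONE INSTANCE OF LEMMA 2.4** (one step `k`, one block point `y ∈ Λ₇^{(k−1)′}`), in the lineage's matrix coordinates.
DATA: the step `k ≥ 1` and the running coefficients `(a, m²)` in the window (`a_k = B1.aSeq a L k`, `m² ↤ m²(L^kε)²`);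
the unit box `□₂ = Π[0,M_μ)` (`boxDom M`) with its fine box `□ = B^k(□₂)` (`Box d ℓ k M`); the coupling `κ = e(L^kε)η`;
a contour system `Γ^{(k)}_{y′,x}` ending at the averaged point (`emb`, `Γ`, `hend`); `A^{(k)}` on `□` as
`Ã = constBond A₀ + A'`, `A₀ = A^{(k)}(y)` the constant field, with the printed «A^{(k)} − A₀ = O(p(L^kε)r(L^kε))» as the
bond size bound `|κA'_b| ≤ θ/n` and the contour bound `|κA'(Γ_{y′,x})| ≤ τ` (`θ, τ ≤ 1`); invertibility of `H_k(□,Ã)`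
(`hunit`); the block point `y`, the set `□₁ ∋ y` of unit sites, the unit-lattice field `φ` on `□₂`; the scales
`p = p(L^kε)`, `q = p(L^{k−1}ε)` (`q ≤ K₃p`), the threshold `t_φ = c₁λ(L^{k−1}ε)^{−1/4}` of (2.55)₄, the distances `R₁`
(from `B^k(y)` to `□ ∖ B^k(□₁)`, in `L^k`-units), `R₂` (from `B^k(y)` to `Λ₆ ∖ □₁`), `R₄` (from `B^k(y)` to `□^c`), and the
SCALE HYPOTHESES `kap` ((2.75): `m²/(a_k+m²)·t_φ ≤ K₁`), `sepG/sepD/sepO₂/sepO₄` (`e^{−δ₀R}t_φ ≤ K`: «r(L^kε)» beats the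
threshold), `θ_scale/τ_scale` (`θt_φ ≤ Kθ`, `τt_φ ≤ Kτ`: the «O((L^kε)^{κ₀})» of (2.68)).  OUTER DATA for (2.56)/(2.67): the
unit sites `Tout` of `Λ₆^{(k−1)′}` (type `Yo`) containing `□₁` via `inc`, the kernel rows `KΩ(x,y′) = a_k(G_k(Ω,A^{(k)})
Q_k^*(A^{(k)}))(x,y′)` for `x ∈ □`, the field `φ` on `Tout` (`φΩ`, agreeing with `φ` on `□₁`), distances `dΩ`.
HYPOTHESIS FIELDS = the printed inputs: Proposition 2.2 (2.58) on `Ω = B^k(Λ₂)` for the rows at `x ∈ B^k(y)` — decay off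
`□₁` (`kerΩ_far`, `dkerΩ_far`) and the `δG`-clause against `□` (`kerΩ_near`, `dkerΩ_near`, extra factor `e^{−δ₀R₄}`);
Proposition I.2.2 for `(□, A^{(k)})` as the sup bounds `sup_g`, `sup_Dg`; and `remD` — the one piece of the printed «and
similarly for the derivative» (the term `D^η_{A₀}G_k(□,A₀)D^{η*}_{A₀}F_{1,k}g` of the derivative of (2.68) at the points of
`B^k(y)`) that the formalised members of [B4] (2.17) do not control (cell GAPS.md `G-B2-Lem24-D`), with its scale `ED ≤ KD·q`.
The restrictions (2.55) are NOT fields: they form the predicate `Model.Restr` (= `restr255` of the row's carrier).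
[cite: Balaban1982Higgs2, (2.55)–(2.56) p. 570, (2.58) p. 570–571, Lemma 2.4 and its proof pp. 572–574] -/
structure Model {d : ℕ} (fr : Frame ι d) (Yo : Type) [Fintype Yo] [DecidableEq Yo] where
  k : ℕ
  hk : 1 ≤ k
  a : ℝ
  m2 : ℝ
  ha1 : fr.amin ≤ a
  ha2 : a ≤ fr.aplus
  hm1 : 0 ≤ m2
  hm2 : m2 ≤ fr.m2plus
  M : Fin (d + 1) → ℕ
  hM : ∀ i, 1 ≤ M i
  κ : ℝ
  emb : ↥(boxDom M) → ↥(Box d fr.ℓ k M)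
  Γ : ↥(boxDom M) → ↥(Box d fr.ℓ k M) → List ↥(Box d fr.ℓ k M)
  hend : ∀ y x, blkWt ((fr.ℓ + 1) ^ k) M (fun i => (fr.ℓ + 1) ^ k * M i) y x ≠ 0 → pathEnd (emb y) (Γ y x) = x
  A₀ : Fin (d + 1) → ℝ
  A' : ↥(Box d fr.ℓ k M) → ↥(Box d fr.ℓ k M) → ℝ
  θ : ℝ
  τ : ℝ
  hθ : 0 ≤ θ
  hθ1 : θ ≤ 1
  hA' : ∀ x y : ↥(Box d fr.ℓ k M), y.1 ∈ nbrs x.1 → |κ * A' x y| ≤ θ / ((fr.ℓ + 1) ^ k : ℕ)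
  hτ : 0 ≤ τ
  hτ1 : τ ≤ 1
  hτA : ∀ y x, blkWt ((fr.ℓ + 1) ^ k) M (fun i => (fr.ℓ + 1) ^ k * M i) y x ≠ 0 →
    |κ * lsum A' (emb y) (Γ y x)| ≤ τ
  hunit : IsUnit (opA d fr.F κ fr.ℓ k a m2 M emb Γ (constBond A₀ Subtype.val + A')).det
  y : ↥(boxDom M)
  sq1 : Finset ↥(boxDom M)
  y_mem : y ∈ sq1
  φ : ↥(boxDom M) → ι → ℝ
  p : ℝ
  q : ℝ
  tφ : ℝ
  R₁ : ℝ
  R₂ : ℝ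
  R₄ : ℝ
  ED : ℝ
  p_nonneg : 0 ≤ p
  q_nonneg : 0 ≤ q
  tφ_nonneg : 0 ≤ tφ
  R₂_nonneg : 0 ≤ R₂
  q_le : q ≤ fr.K₃ * p
  kap : m2 / (B1.aSeq a ((fr.ℓ : ℝ) + 1) k + m2) * tφ ≤ fr.K₁
  sepG : Real.exp (-(fr.dG * R₁)) * tφ ≤ fr.K₂
  sepD : Real.exp (-(fr.dD * R₁)) * tφ ≤ fr.K₂
  sepO₂ : Real.exp (-(fr.δO / 2 * R₂)) * tφ ≤ fr.K₄
  sepO₄ : Real.exp (-(fr.δO * R₄)) * tφ ≤ fr.K₅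
  θ_scale : θ * tφ ≤ fr.Kθ
  τ_scale : τ * tφ ≤ fr.Kτ
  ED_le : ED ≤ fr.KD * q
  far1 : ∀ x : ↥(Box d fr.ℓ k M), blkSite d fr.ℓ k M x = y → ∀ x' : ↥(Box d fr.ℓ k M), blkSite d fr.ℓ k M x' ∉ sq1 →
    R₁ ≤ supNorm (x.1 - x'.1) / (((fr.ℓ + 1) ^ k : ℕ) : ℝ)
  Tout : Finset Yo
  inc : ↥(boxDom M) → Yo
  inc_inj : Function.Injective inc
  inc_mem : ∀ y' ∈ sq1, inc y' ∈ Tout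
  KΩ : ↥(Box d fr.ℓ k M) → Yo → Matrix ι ι ℝ
  φΩ : Yo → ι → ℝ
  φΩ_inc : ∀ y' ∈ sq1, φΩ (inc y') = φ y'
  dΩ : ↥(Box d fr.ℓ k M) → Yo → ℝ
  dΩ_nonneg : ∀ x y', 0 ≤ dΩ x y'
  summableΩ : ∀ x, ∑ y' ∈ Tout, Real.exp (-(fr.δO / 2 * dΩ x y')) ≤ fr.SO
  kerΩ_far : ∀ x, blkSite d fr.ℓ k M x = y → ∀ y' ∈ Tout, y' ∉ sq1.image inc → ∀ v,
    siteNorm (KΩ x y' *ᵥ v) ≤ fr.cO * Real.exp (-(fr.δO * dΩ x y')) * siteNorm v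
  farΩ : ∀ x, blkSite d fr.ℓ k M x = y → ∀ y' ∈ Tout, y' ∉ sq1.image inc → R₂ ≤ dΩ x y'
  kerΩ_near : ∀ x, blkSite d fr.ℓ k M x = y → ∀ y' ∈ sq1, ∀ v,
    siteNorm ((KΩ x (inc y') - kerBox d fr.F κ fr.ℓ k a m2 M emb Γ A₀ A' x y') *ᵥ v)
      ≤ fr.cO * Real.exp (-(fr.δO * R₄)) * Real.exp (-(fr.δO * dΩ x (inc y'))) * siteNorm v
  dkerΩ_far : ∀ (μ : Fin (d + 1)) (x : ↥(Box d fr.ℓ k M)), blkSite d fr.ℓ k M x = y →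
    ∀ (h : x.1 + e1 μ ∈ Box d fr.ℓ k M), ∀ y' ∈ Tout, y' ∉ sq1.image inc → ∀ v,
    siteNorm (dKer d fr.F κ fr.ℓ k M (constBond A₀ Subtype.val + A') KΩ μ x h y' *ᵥ v)
      ≤ fr.cO * Real.exp (-(fr.δO * dΩ x y')) * siteNorm v
  dkerΩ_near : ∀ (μ : Fin (d + 1)) (x : ↥(Box d fr.ℓ k M)), blkSite d fr.ℓ k M x = y →
    ∀ (h : x.1 + e1 μ ∈ Box d fr.ℓ k M), ∀ y' ∈ sq1, ∀ v,
    siteNorm ((dKer d fr.F κ fr.ℓ k M (constBond A₀ Subtype.val + A') KΩ μ x h (inc y')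
        - dkerBox d fr.F κ fr.ℓ k a m2 M emb Γ A₀ A' μ x y') *ᵥ v)
      ≤ fr.cO * Real.exp (-(fr.δO * R₄)) * Real.exp (-(fr.δO * dΩ x (inc y'))) * siteNorm v
  sup_g : supN (gVec d fr.F κ fr.ℓ k a m2 M emb Γ A₀ A' (boxOneField sq1 φ)) ≤ fr.cI * supN (boxOneField sq1 φ)
  sup_Dg : ∀ μ, supN (derivA d fr.F κ fr.ℓ k M (constBond A₀ Subtype.val + A') μ
      *ᵥ gVec d fr.F κ fr.ℓ k a m2 M emb Γ A₀ A' (boxOneField sq1 φ)) ≤ fr.cI * supN (boxOneField sq1 φ)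
  remD : ∀ (μ : Fin (d + 1)) (x : ↥(Box d fr.ℓ k M)), blkSite d fr.ℓ k M x = y →
    siteNorm (fld (derivA0 d fr.F κ fr.ℓ k M A₀ μ *ᵥ (greenA0 d fr.F κ fr.ℓ k a m2 M emb Γ A₀
      *ᵥ (B4Lower18Regular.crossOp (boxWt ((fr.ℓ + 1) ^ k) fun i => (fr.ℓ + 1) ^ k * M i)
            (fieldLink fr.F κ (constBond A₀ Subtype.val)) (B4Lower18Regular.pertE (fieldLink fr.F κ A'))
          *ᵥ gVec d fr.F κ fr.ℓ k a m2 M emb Γ A₀ A' (boxOneField sq1 φ)))) x) ≤ ED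

namespace Model

variable {d : ℕ} {fr : Frame ι d} {Yo : Type} [Fintype Yo] [DecidableEq Yo] (m : Model fr Yo)

/-- «the restrictions (2.55)» on the field `φ` as used in the proof (pp. 570, 573): (2.55)₄ `|φ(y′)| ≤ t_φ·p(L^{k−1}ε)` on
`Λ₆`, and (2.55)₃ in the printed integrated covariant form «|U(A₀(⟨y, y′⟩))φ(y′) − φ(y)| ≦ O(1)p(L^kε)» along lattice
paths within the range of `□₁`: `|U(κA₀(y → y′))φ(y′) − φ(y)| ≤ q(r₁ + r₂|x − x′|_∞/L^k)` for `x ∈ B^k(y)`, `x′ ∈ B^k(y′)`,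
`y′ ∈ □₁` (the constant-field transporter `fieldLink … (emb y) (emb y′)` is path independent).
[cite: Balaban1982Higgs2, (2.55) p. 570, p. 573 «The estimates of the covariant derivatives give us»] -/
structure Restr : Prop where
  bound : ∀ y' ∈ m.Tout, siteNorm (m.φΩ y') ≤ m.tφ * m.q
  lip : ∀ x : ↥(Box d fr.ℓ m.k m.M), blkSite d fr.ℓ m.k m.M x = m.y → ∀ x' : ↥(Box d fr.ℓ m.k m.M),
    blkSite d fr.ℓ m.k m.M x' ∈ m.sq1 →
    siteNorm (fieldLink fr.F m.κ (constBond m.A₀ Subtype.val) (m.emb m.y) (m.emb (blkSite d fr.ℓ m.k m.M x'))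
        *ᵥ m.φ (blkSite d fr.ℓ m.k m.M x') - m.φ m.y)
      ≤ m.q * (fr.r₁ + fr.r₂ * (supNorm (x.1 - x'.1) / (((fr.ℓ + 1) ^ m.k : ℕ) : ℝ)))

/-- `□₁φ`. [cite: Balaban1982Higgs2, (2.67) p. 572] -/
abbrev Ψ : ↥(boxDom m.M) × ι → ℝ := boxOneField m.sq1 m.φ

/-- `g = a_kG_k(□,A^{(k)})Q_k^*(A^{(k)})□₁φ`. [cite: Balaban1982Higgs2, (2.67) p. 572] -/
abbrev g : ↥(Box d fr.ℓ m.k m.M) × ι → ℝ := gVec d fr.F m.κ fr.ℓ m.k m.a m.m2 m.M m.emb m.Γ m.A₀ m.A' m.Ψ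

/-- `a_kG_k(□,A₀)Q_k^*(A₀)□₁φ` — the main term of (2.68). [cite: Balaban1982Higgs2, (2.68) p. 572] -/
abbrev main : ↥(Box d fr.ℓ m.k m.M) × ι → ℝ :=
  B1.aSeq m.a ((fr.ℓ : ℝ) + 1) m.k • (greenA0 d fr.F m.κ fr.ℓ m.k m.a m.m2 m.M m.emb m.Γ m.A₀
    *ᵥ ((avgA d fr.F m.κ fr.ℓ m.k m.M m.emb m.Γ (constBond m.A₀ Subtype.val))ᵀ *ᵥ m.Ψ))

/-- `φ′ = ℋᵀ□₁φ` — the gauge-transformed unit-lattice field of p. 573. [cite: Balaban1982Higgs2, p. 573] -/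
abbrev φ' : ↥(boxDom m.M) × ι → ℝ :=
  (B4GaugeCovariance.blockDiag (gaugeU d fr.F m.κ fr.ℓ m.k m.M m.A₀ ∘ m.emb))ᵀ *ᵥ m.Ψ

/-- `a_k(G_k(□,0)⊗1)Q_k^*□₁φ′` — the gauged main term of (2.74). [cite: Balaban1982Higgs2, (2.74) p. 573] -/
abbrev w : ↥(Box d fr.ℓ m.k m.M) × ι → ℝ :=
  B1.aSeq m.a ((fr.ℓ : ℝ) + 1) m.k • ((gk d fr.ℓ m.k m.a m.m2 m.M ⊗ₖ (1 : Matrix ι ι ℝ))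
    *ᵥ ((avgOne ι d fr.ℓ m.k m.M)ᵀ *ᵥ m.φ'))

/-- **(2.56) in kernel form**: `φ^{(k)}(x) = Σ_{y′ ∈ Λ₆} a_k(G_k(Ω,A^{(k)})Q_k^*(A^{(k)}))(x,y′)φ(y′)`, `x ∈ □`.
[cite: Balaban1982Higgs2, (2.56) p. 570] -/
def φk (x : ↥(Box d fr.ℓ m.k m.M)) : ι → ℝ := ∑ y' ∈ m.Tout, m.KΩ x y' *ᵥ m.φΩ y'

/-- `(D^η_{A^{(k)},μ}φ^{(k)})(b)` for a bond `b = (x, x+e_μ)` of `□`, in kernel form. [cite: Balaban1982Higgs2, (2.66) p. 572] -/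
def dφk (μ : Fin (d + 1)) (x : ↥(Box d fr.ℓ m.k m.M)) (h : x.1 + e1 μ ∈ Box d fr.ℓ m.k m.M) : ι → ℝ :=
  ∑ y' ∈ m.Tout, dKer d fr.F m.κ fr.ℓ m.k m.M (constBond m.A₀ Subtype.val + m.A') m.KΩ μ x h y' *ᵥ m.φΩ y'

/-- `U(A^{(k)}(Γ^{(k)}_{x,y}))φ(y) = U(A^{(k)}(Γ^{(k)}_{y,x}))ᵀφ(y)` («the contour Γ_{x,y} = −Γ_{y,x}»).
[cite: Balaban1982Higgs2, (2.65) p. 572] -/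
abbrev target (x : ↥(Box d fr.ℓ m.k m.M)) : ι → ℝ :=
  (contourTrans (fieldLink fr.F m.κ (constBond m.A₀ Subtype.val + m.A')) m.emb m.Γ m.y x)ᵀ *ᵥ m.φ m.y

/-- the supremum in (2.65), first form: `sup_{x ∈ B^k(y)} |φ^{(k)}(x) − U(A^{(k)}(Γ^{(k)}_{x,y}))φ(y)|`.
[cite: Balaban1982Higgs2, (2.65) p. 572] -/
def dev265a : ℝ := ⨆ x : {x : ↥(Box d fr.ℓ m.k m.M) // blkSite d fr.ℓ m.k m.M x = m.y}, siteNorm (m.φk x.1 - m.target x.1)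

/-- the supremum in (2.65), second form: `sup_{x ∈ B^k(y)} |φ^{(k)}(x) − (Q_k^*(A^{(k)})φ)(x)|`.
[cite: Balaban1982Higgs2, (2.65) p. 572] -/
def dev265b : ℝ := ⨆ x : {x : ↥(Box d fr.ℓ m.k m.M) // blkSite d fr.ℓ m.k m.M x = m.y},
  siteNorm (m.φk x.1 - fld ((avgA d fr.F m.κ fr.ℓ m.k m.M m.emb m.Γ (constBond m.A₀ Subtype.val + m.A'))ᵀ *ᵥ m.Ψ) x.1)

/-- the supremum in (2.66): `sup |(D^η_{A^{(k)}}φ^{(k)})(b)|` over the bonds `b = (x, x+e_μ) ⊂ □`, `x ∈ B^k(y)`.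
[cite: Balaban1982Higgs2, (2.66) p. 572] -/
def dev266 : ℝ := ⨆ b : {b : Fin (d + 1) × ↥(Box d fr.ℓ m.k m.M) //
    blkSite d fr.ℓ m.k m.M b.2 = m.y ∧ b.2.1 + e1 b.1 ∈ Box d fr.ℓ m.k m.M}, siteNorm (m.dφk b.1.1 b.1.2 b.2.2)

end Model

end ModelDef

/-! ## §6 The estimates for one instance -/

section Estimates

namespace Model

variable {d : ℕ} {fr : Frame ι d} {Yo : Type} [Fintype Yo] [DecidableEq Yo] (m : Model fr Yo)

/-! ### Window facts -/

/-- `L = ℓ + 1 > 1`. [cite: Balaban1982Higgs2, (2.1) p. 557] -/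
theorem hL : (1 : ℝ) < (fr.ℓ : ℝ) + 1 := by
  have : (1 : ℝ) ≤ (fr.ℓ : ℝ) := by exact_mod_cast fr.hℓ
  linarith

/-- `a > 0`. [cite: Balaban1982Higgs2, Lemma 2.4 p. 572] -/
theorem ha' : 0 < m.a := lt_of_lt_of_le fr.ha m.ha1

/-- `a_k > 0`. [cite: Balaban1982Higgs1, (2.15) p. 609] -/
theorem hak : 0 < B1.aSeq m.a ((fr.ℓ : ℝ) + 1) m.k := B1.aSeq_pos m.ha' hL m.hk

/-- `a_k ≤ a ≤ a₊`. [cite: Balaban1982Higgs1, (2.15) p. 609] -/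
theorem hakle : B1.aSeq m.a ((fr.ℓ : ℝ) + 1) m.k ≤ fr.aplus := (B1.aSeq_le m.ha' hL m.k m.hk).trans m.ha2

/-- `n = L^k ≥ 1`. [cite: Balaban1982Higgs2, p. 570 «η = L^{−k}»] -/
theorem hn : 1 ≤ (fr.ℓ + 1) ^ m.k := Nat.one_le_pow _ _ (Nat.succ_pos _)

/-! ### `□₁φ`, `φ′` and the restrictions -/

/-- `□₁φ = φ` on `□₁`. [cite: Balaban1982Higgs2, p. 572] -/
theorem fld_Ψ_of_mem {y' : ↥(boxDom m.M)} (h : y' ∈ m.sq1) : fld m.Ψ y' = m.φ y' :=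
  fld_boxOneField_of_mem m.φ h

/-- `□₁φ = 0` off `□₁`. [cite: Balaban1982Higgs2, p. 572] -/
theorem fld_Ψ_of_not_mem {y' : ↥(boxDom m.M)} (h : y' ∉ m.sq1) : fld m.Ψ y' = 0 :=
  fld_boxOneField_of_not_mem m.φ h

/-- (2.55)₄ on `□₁`: `|φ(y′)| ≤ t_φq`. [cite: Balaban1982Higgs2, (2.55) p. 570] -/
theorem siteNorm_φ_le (hR : m.Restr) {y' : ↥(boxDom m.M)} (h : y' ∈ m.sq1) : siteNorm (m.φ y') ≤ m.tφ * m.q := by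
  rw [← m.φΩ_inc y' h]
  exact hR.bound _ (m.inc_mem y' h)

/-- `‖□₁φ‖_∞ ≤ t_φq`. [cite: Balaban1982Higgs2, (2.55) p. 570] -/
theorem supN_Ψ_le (hR : m.Restr) : supN m.Ψ ≤ m.tφ * m.q :=
  supN_le (mul_nonneg m.tφ_nonneg m.q_nonneg) fun y' => by
    by_cases h : y' ∈ m.sq1
    · rw [m.fld_Ψ_of_mem h]; exact m.siteNorm_φ_le hR h
    · rw [m.fld_Ψ_of_not_mem h, siteNorm_zero]; exact mul_nonneg m.tφ_nonneg m.q_nonneg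

/-- `φ′(y′) = 𝒢(emb y′)ᵀ(□₁φ)(y′)`. [cite: Balaban1982Higgs2, p. 573 «φ(y′) = U(A₀(Γ_{y′,y}))φ′(y′)»] -/
theorem fld_φ' (y' : ↥(boxDom m.M)) :
    fld m.φ' y' = (gaugeU d fr.F m.κ fr.ℓ m.k m.M m.A₀ (m.emb y'))ᵀ *ᵥ fld m.Ψ y' := by
  dsimp only [φ']
  rw [B4GaugeCovariance.blockDiag_transpose, fld_blockDiag_mulVec]
  rfl

/-- `φ′ = 0` off `□₁`. [cite: Balaban1982Higgs2, p. 573] -/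
theorem fld_φ'_of_not_mem {y' : ↥(boxDom m.M)} (h : y' ∉ m.sq1) : fld m.φ' y' = 0 := by
  rw [m.fld_φ', m.fld_Ψ_of_not_mem h, mulVec_zero]

/-- `|φ′(y)| = |φ(y)| ≤ t_φq`. [cite: Balaban1982Higgs2, (2.55) p. 570, p. 573] -/
theorem siteNorm_fld_φ'_y (hR : m.Restr) : siteNorm (fld m.φ' m.y) ≤ m.tφ * m.q := by
  rw [m.fld_φ', m.fld_Ψ_of_mem m.y_mem]
  dsimp only [gaugeU]
  rw [fr.F.transpose_eq, siteNorm_flow]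
  exact m.siteNorm_φ_le hR m.y_mem

/-- the constant-field unit transporter is the pure gauge: `U(κA₀(y → y′)) = 𝒢(emb y)𝒢(emb y′)ᵀ`.
[cite: Balaban1982Higgs2, (2.71)–(2.72) p. 573] -/
theorem fieldLink_constBond_emb (y₁ y₂ : ↥(boxDom m.M)) :
    fieldLink fr.F m.κ (constBond m.A₀ Subtype.val) (m.emb y₁) (m.emb y₂)
      = gaugeU d fr.F m.κ fr.ℓ m.k m.M m.A₀ (m.emb y₁) * (gaugeU d fr.F m.κ fr.ℓ m.k m.M m.A₀ (m.emb y₂))ᵀ := by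
  rw [fieldLink_constBond, gaugeKer_apply, Matrix.mul_one]

/-- **«After the gauge transformation we finally get |φ′(y″) − φ′(y′)| ≦ O(1)p(L^kε)»**: the integrated restriction in the
gauge `φ′ = ℋᵀφ`: `|φ′(y(x′)) − φ′(y)| ≤ q(r₁ + r₂|x − x′|_∞/L^k)` for `x ∈ B^k(y)`, `y(x′) ∈ □₁`.
[cite: Balaban1982Higgs2, p. 573] -/
theorem lip_φ' (hR : m.Restr) (x : ↥(Box d fr.ℓ m.k m.M)) (hx : blkSite d fr.ℓ m.k m.M x = m.y)
    (x' : ↥(Box d fr.ℓ m.k m.M)) (hx' : blkSite d fr.ℓ m.k m.M x' ∈ m.sq1) :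
    siteNorm (fld m.φ' (blkSite d fr.ℓ m.k m.M x') - fld m.φ' m.y)
      ≤ m.q * (fr.r₁ + fr.r₂ * (supNorm (x.1 - x'.1) / (((fr.ℓ + 1) ^ m.k : ℕ) : ℝ))) := by
  have key := hR.lip x hx x' hx'
  rw [m.fld_φ', m.fld_φ', m.fld_Ψ_of_mem hx', m.fld_Ψ_of_mem m.y_mem]
  set gy := gaugeU d fr.F m.κ fr.ℓ m.k m.M m.A₀ (m.emb m.y) with hgy
  set gb := gaugeU d fr.F m.κ fr.ℓ m.k m.M m.A₀ (m.emb (blkSite d fr.ℓ m.k m.M x')) with hgb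
  have hgg : gy * gyᵀ = 1 :=
    (fr.F.isGauge (fun u : ↥(Box d fr.ℓ m.k m.M) => m.κ * linGauge m.A₀ Subtype.val u)).mul_transpose (m.emb m.y)
  have h1 : gy *ᵥ (gbᵀ *ᵥ m.φ (blkSite d fr.ℓ m.k m.M x') - gyᵀ *ᵥ m.φ m.y)
      = fieldLink fr.F m.κ (constBond m.A₀ Subtype.val) (m.emb m.y) (m.emb (blkSite d fr.ℓ m.k m.M x'))
          *ᵥ m.φ (blkSite d fr.ℓ m.k m.M x') - m.φ m.y := by
    rw [mulVec_sub, mulVec_mulVec, mulVec_mulVec, hgg, one_mulVec, m.fieldLink_constBond_emb]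
  have h2 : siteNorm (gbᵀ *ᵥ m.φ (blkSite d fr.ℓ m.k m.M x') - gyᵀ *ᵥ m.φ m.y)
      = siteNorm (gy *ᵥ (gbᵀ *ᵥ m.φ (blkSite d fr.ℓ m.k m.M x') - gyᵀ *ᵥ m.φ m.y)) := by
    rw [hgy]; exact (siteNorm_flow fr.F _ _).symm
  rw [h2, h1]
  exact key

/-! ### The main term: (2.74), (2.76) and the transporter comparison -/

/-- (2.74) for the instance: `main = 𝒢w`. [cite: Balaban1982Higgs2, (2.74) p. 573] -/
theorem main_eq : m.main = B4GaugeCovariance.blockDiag (gaugeU d fr.F m.κ fr.ℓ m.k m.M m.A₀) *ᵥ m.w :=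
  main_gauge fr.F m.κ fr.hℓ m.hk m.ha' m.hm1 m.hM m.hend m.A₀ _ m.Ψ

/-- **(2.74)+(2.76) AT A POINT OF `B^k(y)`**: `|(a_kG_k(□,A₀)Q_k^*(A₀)□₁φ)(x) − U(A₀(Γ_{x,·}))φ′(y)| ≤
[a₊c₀(r₁ + r₂/δ₀) + a₊c₀K₂ + K₁]·q`. [cite: Balaban1982Higgs2, (2.74), (2.76) p. 573] -/
theorem main_site_le (hR : m.Restr) (x : ↥(Box d fr.ℓ m.k m.M)) (hx : blkSite d fr.ℓ m.k m.M x = m.y) :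
    siteNorm (fld m.main x - gaugeU d fr.F m.κ fr.ℓ m.k m.M m.A₀ x *ᵥ fld m.φ' m.y)
      ≤ (fr.aplus * (fr.kG * (fr.r₁ + fr.r₂ / fr.dG)) + fr.aplus * (fr.kG * fr.K₂) + fr.K₁) * m.q := by
  rw [m.main_eq, siteNorm_gauge_sub]
  have h := eq276_site (ι := ι) fr.hℓ m.hk fr.ha m.ha1 m.ha2 m.hm1 m.hm2 m.hM m.sq1 m.y m.φ'
    (fun y' hy' => m.fld_φ'_of_not_mem hy') m.q_nonneg fr.r₁_nonneg fr.r₂_nonneg (m.siteNorm_fld_φ'_y hR) x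
    (m.lip_φ' hR x hx) (m.far1 x hx)
  refine h.trans ?_
  have hkG : 0 ≤ fr.kG := (δG_spec d fr.ℓ fr.hℓ fr.amin fr.aplus fr.m2plus fr.ha).2.1.le
  have e1 : fr.aplus * (Real.exp (-(fr.dG * m.R₁)) * fr.kG * m.tφ) * m.q ≤ fr.aplus * (fr.kG * fr.K₂) * m.q := by
    have : Real.exp (-(fr.dG * m.R₁)) * fr.kG * m.tφ ≤ fr.kG * fr.K₂ := by
      calc Real.exp (-(fr.dG * m.R₁)) * fr.kG * m.tφ = fr.kG * (Real.exp (-(fr.dG * m.R₁)) * m.tφ) := by ring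
        _ ≤ fr.kG * fr.K₂ := mul_le_mul_of_nonneg_left m.sepG hkG
    exact mul_le_mul_of_nonneg_right (mul_le_mul_of_nonneg_left this (m.hak.le.trans m.hakle)) m.q_nonneg
  have e2 : m.m2 / (B1.aSeq m.a ((fr.ℓ : ℝ) + 1) m.k + m.m2) * m.tφ * m.q ≤ fr.K₁ * m.q :=
    mul_le_mul_of_nonneg_right m.kap m.q_nonneg
  linarith

/-- **THE TRANSPORTER COMPARISON**: `|U(A₀(Γ_{x,·}))φ′(y) − U(A^{(k)}(Γ^{(k)}_{x,y}))φ(y)| ≤ ℓ₁τ·|φ(y)| ≤ ℓ₁K_τq` — the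
printed «taking into account the equalities φ′(y) = φ(y), U(A₀(Γ_{x,y}))φ(y) = U(A^{(k)}(Γ^{(k)}_{x,y}))φ(y) + O((L^kε)^{κ₀})»
(`U(A^{(k)}(Γ)) = U(A'(Γ))U(A₀(Γ))`, `|U(κA'(Γ)) − 1| ≤ ℓ₁τ`). [cite: Balaban1982Higgs2, p. 573] -/
theorem target_site_le (hR : m.Restr) (x : ↥(Box d fr.ℓ m.k m.M)) (hx : blkSite d fr.ℓ m.k m.M x = m.y) :
    siteNorm (gaugeU d fr.F m.κ fr.ℓ m.k m.M m.A₀ x *ᵥ fld m.φ' m.y - m.target x) ≤ fr.ℓ₁ * fr.Kτ * m.q := by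
  have hq : blkWt ((fr.ℓ + 1) ^ m.k) m.M (fun i => (fr.ℓ + 1) ^ m.k * m.M i) m.y x ≠ 0 := by
    rw [blkWt_eq_ite, if_pos hx.symm]; exact one_ne_zero
  have hc : ∀ a b u v : ↥(Box d fr.ℓ m.k m.M), fieldLink fr.F m.κ (constBond m.A₀ Subtype.val) a b
      * fieldLink fr.F m.κ m.A' u v = fieldLink fr.F m.κ m.A' u v * fieldLink fr.F m.κ (constBond m.A₀ Subtype.val) a b :=
    fun a b u v => fr.F.comm _ _
  have hT : contourTrans (fieldLink fr.F m.κ (constBond m.A₀ Subtype.val + m.A')) m.emb m.Γ m.y x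
      = fr.F.U (m.κ * lsum m.A' (m.emb m.y) (m.Γ m.y x))
        * (gaugeU d fr.F m.κ fr.ℓ m.k m.M m.A₀ (m.emb m.y) * (gaugeU d fr.F m.κ fr.ℓ m.k m.M m.A₀ x)ᵀ) := by
    rw [fieldLink_add, contourTrans_kmul hc, B4Lower18Regular.kmul_apply, contourTrans_fieldLink,
      contourTrans_constBond fr.F m.κ fr.ℓ m.k m.M m.hend m.A₀ hx]
  dsimp only [target]
  rw [hT, m.fld_φ', m.fld_Ψ_of_mem m.y_mem, Matrix.transpose_mul, Matrix.transpose_mul, Matrix.transpose_transpose,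
    ← mulVec_mulVec, ← mulVec_mulVec, ← mulVec_sub, ← mulVec_sub]
  dsimp only [gaugeU]
  rw [siteNorm_flow, fr.F.transpose_eq, siteNorm_flow, fr.F.transpose_eq]
  have h1 : m.φ m.y - fr.F.U (-(m.κ * lsum m.A' (m.emb m.y) (m.Γ m.y x))) *ᵥ m.φ m.y
      = -((fr.F.U (-(m.κ * lsum m.A' (m.emb m.y) (m.Γ m.y x))) - 1) *ᵥ m.φ m.y) := by
    rw [sub_mulVec, one_mulVec, neg_sub]
  rw [h1, siteNorm_neg]
  refine (siteNorm_flow_sub_one_le fr.F fr.hℓ₁ fr.hLip _ _).trans ?_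
  rw [abs_neg]
  calc fr.ℓ₁ * |m.κ * lsum m.A' (m.emb m.y) (m.Γ m.y x)| * siteNorm (m.φ m.y)
      ≤ fr.ℓ₁ * m.τ * (m.tφ * m.q) :=
        mul_le_mul (mul_le_mul_of_nonneg_left (m.hτA m.y x hq) fr.hℓ₁) (m.siteNorm_φ_le hR m.y_mem)
          (siteNorm_nonneg _) (mul_nonneg fr.hℓ₁ m.hτ)
    _ = fr.ℓ₁ * m.q * (m.τ * m.tφ) := by ring
    _ ≤ fr.ℓ₁ * m.q * fr.Kτ := mul_le_mul_of_nonneg_left m.τ_scale (mul_nonneg fr.hℓ₁ m.q_nonneg)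
    _ = fr.ℓ₁ * fr.Kτ * m.q := by ring

end Model

end Estimates

/-! ## §7 (2.67): the localization `φ^{(k)} → a_kG_k(□,A^{(k)})Q_k^*(A^{(k)})□₁φ` from Proposition 2.2 on `Ω` -/

section Outer

omit [DecidableEq ι] in
/-- `e^{−δd} ≤ e^{−(δ/2)d}` for `δ, d ≥ 0`. [folklore] -/
private theorem exp_half_le {δ t : ℝ} (hδ : 0 ≤ δ) (ht : 0 ≤ t) : Real.exp (-(δ * t)) ≤ Real.exp (-(δ / 2 * t)) := by
  rw [Real.exp_le_exp]; nlinarith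

omit [DecidableEq ι] in
/-- **THE ENGINE OF (2.67)** («Using Proposition 2.2 and the restrictions (2.55) we get (2.67)»): an outer kernel row
`K_Ω(x,·)` on the sites `T` of `Λ₆`, agreeing with the box kernel row `K_□(x,·)` on `□₁` up to the `δG`-clause factor
`c₀e^{−δ₀R₄}e^{−δ₀|x−y′|}`, decaying as `c₀e^{−δ₀|x−y′|}` off `□₁` where `|x − y′| ≥ R₂`, applied to a field bounded by
`t` and equal to `φ` on `□₁`: `|Σ_T K_Ωφ − Σ K_□(□₁φ)| ≤ c₀S(e^{−δ₀R₄}t + e^{−δ₀R₂/2}t)`.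
[cite: Balaban1982Higgs2, (2.67) p. 572, Proposition 2.2 (2.58) pp. 570–571] -/
theorem outer_engine {Yb Yo : Type*} [Fintype Yb] [DecidableEq Yo] (sq1 : Finset Yb)
    (Tout : Finset Yo) (inc : Yb → Yo) (hinj : Function.Injective inc) (hmem : ∀ y' ∈ sq1, inc y' ∈ Tout)
    (KO : Yo → Matrix ι ι ℝ) (KB : Yb → Matrix ι ι ℝ) (φ : Yb → ι → ℝ) (φO : Yo → ι → ℝ)
    (hφ : ∀ y' ∈ sq1, φO (inc y') = φ y') (Ψv : Yb → ι → ℝ) (hΨ1 : ∀ y' ∈ sq1, Ψv y' = φ y')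
    (hΨ0 : ∀ y', y' ∉ sq1 → Ψv y' = 0) {cO δ S tq R₂ R₄ : ℝ} (hcO : 0 ≤ cO) (hδ : 0 < δ) (htq : 0 ≤ tq)
    (dO : Yo → ℝ) (hd : ∀ y', 0 ≤ dO y') (hsum : ∑ y' ∈ Tout, Real.exp (-(δ / 2 * dO y')) ≤ S)
    (hfar : ∀ y' ∈ Tout, y' ∉ sq1.image inc → ∀ v,
      siteNorm (KO y' *ᵥ v) ≤ cO * Real.exp (-(δ * dO y')) * siteNorm v)
    (hR₂ : ∀ y' ∈ Tout, y' ∉ sq1.image inc → R₂ ≤ dO y')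
    (hnear : ∀ y' ∈ sq1, ∀ v, siteNorm ((KO (inc y') - KB y') *ᵥ v)
      ≤ cO * Real.exp (-(δ * R₄)) * Real.exp (-(δ * dO (inc y'))) * siteNorm v)
    (hbound : ∀ y' ∈ Tout, siteNorm (φO y') ≤ tq) :
    siteNorm (∑ y' ∈ Tout, KO y' *ᵥ φO y' - ∑ y', KB y' *ᵥ Ψv y')
      ≤ cO * S * (Real.exp (-(δ * R₄)) * tq) + cO * S * (Real.exp (-(δ / 2 * R₂)) * tq) := by
  classical
  have hS : 0 ≤ S := le_trans (sum_nonneg fun _ _ => (Real.exp_pos _).le) hsum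
  -- the box sum lives on `□₁`
  have hB : ∑ y', KB y' *ᵥ Ψv y' = ∑ y' ∈ sq1, KB y' *ᵥ φ y' := by
    rw [← Finset.sum_subset (Finset.subset_univ sq1) (fun y' _ hy' => by rw [hΨ0 y' hy', mulVec_zero])]
    exact sum_congr rfl fun y' hy' => by rw [hΨ1 y' hy']
  -- the outer sum splits into `□₁` (through `inc`) and the far sites
  have himg : Tout.filter (fun y' => y' ∈ sq1.image inc) = sq1.image inc := by
    ext y'
    simp only [mem_filter, mem_image, and_iff_right_iff_imp]
    rintro ⟨y₁, hy₁, rfl⟩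
    exact hmem y₁ hy₁
  have hnearsum : ∑ y' ∈ sq1.image inc, KO y' *ᵥ φO y' = ∑ y' ∈ sq1, KO (inc y') *ᵥ φ y' := by
    rw [Finset.sum_image fun a _ b _ h => hinj h]
    exact sum_congr rfl fun y' hy' => by rw [hφ y' hy']
  have hsplit : ∑ y' ∈ Tout, KO y' *ᵥ φO y' - ∑ y', KB y' *ᵥ Ψv y'
      = ∑ y' ∈ sq1, (KO (inc y') - KB y') *ᵥ φ y'
        + ∑ y' ∈ Tout.filter (fun y' => ¬ y' ∈ sq1.image inc), KO y' *ᵥ φO y' := by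
    rw [hB, ← Finset.sum_filter_add_sum_filter_not Tout (fun y' => y' ∈ sq1.image inc), himg, hnearsum]
    simp only [sub_mulVec, Finset.sum_sub_distrib]
    abel
  rw [hsplit]
  refine (siteNorm_add_le _ _).trans (add_le_add ?_ ?_)
  · -- the `δG`-clause on `□₁`
    have hw : ∑ y' ∈ sq1, Real.exp (-(δ * dO (inc y'))) ≤ S := by
      rw [← Finset.sum_image (f := fun y' => Real.exp (-(δ * dO y'))) fun a _ b _ h => hinj h]
      calc ∑ y' ∈ sq1.image inc, Real.exp (-(δ * dO y'))
          ≤ ∑ y' ∈ Tout, Real.exp (-(δ * dO y')) :=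
            Finset.sum_le_sum_of_subset_of_nonneg (fun y' hy' => by
              obtain ⟨y₁, hy₁, rfl⟩ := mem_image.1 hy'; exact hmem y₁ hy₁) fun _ _ _ => (Real.exp_pos _).le
        _ ≤ ∑ y' ∈ Tout, Real.exp (-(δ / 2 * dO y')) := sum_le_sum fun y' _ => exp_half_le hδ.le (hd y')
        _ ≤ S := hsum
    calc siteNorm (∑ y' ∈ sq1, (KO (inc y') - KB y') *ᵥ φ y')
        ≤ ∑ y' ∈ sq1, siteNorm ((KO (inc y') - KB y') *ᵥ φ y') := siteNorm_sum_le _ _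
      _ ≤ ∑ y' ∈ sq1, cO * Real.exp (-(δ * R₄)) * Real.exp (-(δ * dO (inc y'))) * tq := by
          refine sum_le_sum fun y' hy' => (hnear y' hy' _).trans ?_
          refine mul_le_mul_of_nonneg_left ?_ (by positivity)
          rw [← hφ y' hy']
          exact hbound _ (hmem y' hy')
      _ = cO * (Real.exp (-(δ * R₄)) * tq) * ∑ y' ∈ sq1, Real.exp (-(δ * dO (inc y'))) := by
          rw [mul_sum]; exact sum_congr rfl fun _ _ => by ring
      _ ≤ cO * (Real.exp (-(δ * R₄)) * tq) * S := mul_le_mul_of_nonneg_left hw (by positivity)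
      _ = cO * S * (Real.exp (-(δ * R₄)) * tq) := by ring
  · -- the far sites
    have hw : ∑ y' ∈ Tout.filter (fun y' => ¬ y' ∈ sq1.image inc), Real.exp (-(δ * dO y'))
        ≤ Real.exp (-(δ / 2 * R₂)) * S := by
      calc ∑ y' ∈ Tout.filter (fun y' => ¬ y' ∈ sq1.image inc), Real.exp (-(δ * dO y'))
          ≤ ∑ y' ∈ Tout.filter (fun y' => ¬ y' ∈ sq1.image inc),
              Real.exp (-(δ / 2 * R₂)) * Real.exp (-(δ / 2 * dO y')) := by
            refine sum_le_sum fun y' hy' => ?_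
            have hR := hR₂ y' (mem_filter.1 hy').1 (mem_filter.1 hy').2
            rw [← Real.exp_add, Real.exp_le_exp]
            nlinarith
        _ = Real.exp (-(δ / 2 * R₂)) * ∑ y' ∈ Tout.filter (fun y' => ¬ y' ∈ sq1.image inc),
              Real.exp (-(δ / 2 * dO y')) := by rw [mul_sum]
        _ ≤ Real.exp (-(δ / 2 * R₂)) * S := by
            refine mul_le_mul_of_nonneg_left ?_ (Real.exp_pos _).le
            exact (Finset.sum_le_sum_of_subset_of_nonneg (Finset.filter_subset _ _)
              fun _ _ _ => (Real.exp_pos _).le).trans hsum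
    calc siteNorm (∑ y' ∈ Tout.filter (fun y' => ¬ y' ∈ sq1.image inc), KO y' *ᵥ φO y')
        ≤ ∑ y' ∈ Tout.filter (fun y' => ¬ y' ∈ sq1.image inc), siteNorm (KO y' *ᵥ φO y') := siteNorm_sum_le _ _
      _ ≤ ∑ y' ∈ Tout.filter (fun y' => ¬ y' ∈ sq1.image inc), cO * Real.exp (-(δ * dO y')) * tq := by
          refine sum_le_sum fun y' hy' => ?_
          have h1 := mem_filter.1 hy'
          exact (hfar y' h1.1 h1.2 _).trans (mul_le_mul_of_nonneg_left (hbound y' h1.1) (by positivity))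
      _ = cO * tq * ∑ y' ∈ Tout.filter (fun y' => ¬ y' ∈ sq1.image inc), Real.exp (-(δ * dO y')) := by
          rw [mul_sum]; exact sum_congr rfl fun _ _ => by ring
      _ ≤ cO * tq * (Real.exp (-(δ / 2 * R₂)) * S) := mul_le_mul_of_nonneg_left hw (by positivity)
      _ = cO * S * (Real.exp (-(δ / 2 * R₂)) * tq) := by ring

namespace Model

variable {d : ℕ} {fr : Frame ι d} {Yo : Type} [Fintype Yo] [DecidableEq Yo] (m : Model fr Yo)

/-- **(2.67) AT A POINT OF `B^k(y)`**: `|φ^{(k)}(x) − (a_kG_k(□,A^{(k)})Q_k^*(A^{(k)})□₁φ)(x)| ≤ c₀S_O(K₅ + K₄)·q`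
(«φ^{(k)}(x) = (a_kG_k(□, A^{(k)})Q_k^*(A^{(k)})□₁φ)(x) + O((L^kε)^κ), x ∈ B^k(y)»).
[cite: Balaban1982Higgs2, (2.67) p. 572] -/
theorem loc267_site (hR : m.Restr) (x : ↥(Box d fr.ℓ m.k m.M)) (hx : blkSite d fr.ℓ m.k m.M x = m.y) :
    siteNorm (m.φk x - fld m.g x) ≤ fr.cO * fr.SO * (fr.K₅ + fr.K₄) * m.q := by
  dsimp only [φk]
  rw [fld_gVec]
  have h := outer_engine (ι := ι) m.sq1 m.Tout m.inc m.inc_inj m.inc_mem (m.KΩ x)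
    (kerBox d fr.F m.κ fr.ℓ m.k m.a m.m2 m.M m.emb m.Γ m.A₀ m.A' x) m.φ m.φΩ m.φΩ_inc (fun y' => fld m.Ψ y')
    (fun y' hy' => m.fld_Ψ_of_mem hy') (fun y' hy' => m.fld_Ψ_of_not_mem hy') fr.cO_nonneg fr.δO_pos
    (mul_nonneg m.tφ_nonneg m.q_nonneg) (m.dΩ x) (m.dΩ_nonneg x) (m.summableΩ x) (m.kerΩ_far x hx) (m.farΩ x hx)
    (m.kerΩ_near x hx) hR.bound
  refine h.trans ?_
  have hcS : 0 ≤ fr.cO * fr.SO := mul_nonneg fr.cO_nonneg fr.SO_nonneg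
  have e1 : fr.cO * fr.SO * (Real.exp (-(fr.δO * m.R₄)) * (m.tφ * m.q)) ≤ fr.cO * fr.SO * fr.K₅ * m.q := by
    have := mul_le_mul_of_nonneg_right m.sepO₄ m.q_nonneg
    nlinarith
  have e2 : fr.cO * fr.SO * (Real.exp (-(fr.δO / 2 * m.R₂)) * (m.tφ * m.q)) ≤ fr.cO * fr.SO * fr.K₄ * m.q := by
    have := mul_le_mul_of_nonneg_right m.sepO₂ m.q_nonneg
    nlinarith
  linarith

/-- **(2.67) FOR THE COVARIANT DERIVATIVE** («and the same equality for the covariant derivative of φ^{(k)}»): for a bond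
`b = (x, x+e_μ) ⊂ □`, `x ∈ B^k(y)`: `|(D^η_{A^{(k)}}φ^{(k)})(b) − (D^η_{A^{(k)}}g)(b)| ≤ c₀S_O(K₅ + K₄)·q`.
[cite: Balaban1982Higgs2, (2.67) p. 572] -/
theorem dloc267_site (hR : m.Restr) (μ : Fin (d + 1)) (x : ↥(Box d fr.ℓ m.k m.M))
    (hx : blkSite d fr.ℓ m.k m.M x = m.y) (h : x.1 + e1 μ ∈ Box d fr.ℓ m.k m.M) :
    siteNorm (m.dφk μ x h - fld (derivA d fr.F m.κ fr.ℓ m.k m.M (constBond m.A₀ Subtype.val + m.A') μ *ᵥ m.g) x)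
      ≤ fr.cO * fr.SO * (fr.K₅ + fr.K₄) * m.q := by
  dsimp only [dφk]
  rw [fld_deriv_gVec]
  have h := outer_engine (ι := ι) m.sq1 m.Tout m.inc m.inc_inj m.inc_mem
    (dKer d fr.F m.κ fr.ℓ m.k m.M (constBond m.A₀ Subtype.val + m.A') m.KΩ μ x h)
    (dkerBox d fr.F m.κ fr.ℓ m.k m.a m.m2 m.M m.emb m.Γ m.A₀ m.A' μ x) m.φ m.φΩ m.φΩ_inc (fun y' => fld m.Ψ y')
    (fun y' hy' => m.fld_Ψ_of_mem hy') (fun y' hy' => m.fld_Ψ_of_not_mem hy') fr.cO_nonneg fr.δO_pos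
    (mul_nonneg m.tφ_nonneg m.q_nonneg) (m.dΩ x) (m.dΩ_nonneg x) (m.summableΩ x) (m.dkerΩ_far μ x hx h)
    (m.farΩ x hx) (m.dkerΩ_near μ x hx h) hR.bound
  refine h.trans ?_
  have hcS : 0 ≤ fr.cO * fr.SO := mul_nonneg fr.cO_nonneg fr.SO_nonneg
  have e1 : fr.cO * fr.SO * (Real.exp (-(fr.δO * m.R₄)) * (m.tφ * m.q)) ≤ fr.cO * fr.SO * fr.K₅ * m.q := by
    have := mul_le_mul_of_nonneg_right m.sepO₄ m.q_nonneg
    nlinarith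
  have e2 : fr.cO * fr.SO * (Real.exp (-(fr.δO / 2 * m.R₂)) * (m.tφ * m.q)) ≤ fr.cO * fr.SO * fr.K₄ * m.q := by
    have := mul_le_mul_of_nonneg_right m.sepO₂ m.q_nonneg
    nlinarith
  linarith

end Model

end Outer

/-! ## §8 The scale bookkeeping («O((L^kε)^{κ₀})», «O(p(L^kε))») and the assembly of (2.65)–(2.66) -/

section Assembly

/-- `Σ_{μ ∈ Fin (d+1)} t = (d+1)·t`. [folklore] -/
private theorem sum_const_dir' (d : ℕ) (t : ℝ) : ∑ _μ : Fin (d + 1), t = ((d : ℝ) + 1) * t := by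
  rw [Finset.sum_const, Finset.card_univ, Fintype.card_fin, nsmul_eq_mul]
  push_cast
  ring

/-- the elementary scale step: `β·t ≤ K ⇒ A·β·(t·q) ≤ A·K·q` (`A, q ≥ 0`). [folklore] -/
private theorem scale_le {A β t K q : ℝ} (hA : 0 ≤ A) (hq : 0 ≤ q) (h : β * t ≤ K) :
    A * β * (t * q) ≤ A * K * q := by
  have := mul_le_mul_of_nonneg_left h (mul_nonneg hA hq)
  nlinarith

namespace Frame

variable {d : ℕ} (fr : Frame ι d)

/-- the coefficient of `q = p(L^{k−1}ε)` in the bound for the (2.68) remainder once Proposition I.2.2 and the scale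
hypotheses are used (`c` = the uniform constant of `remainder268_sup`/`remainder268_deriv_site`).
[cite: Balaban1982Higgs2, (2.68) p. 572] -/
def C68 (c : ℝ) : ℝ :=
  c * (fr.aplus * fr.ℓ₁ * fr.Kτ + ((d : ℝ) + 1) * fr.ℓ₁ * fr.Kθ * (((d : ℝ) + 1) * (fr.cI * (1 + fr.ℓ₁)))
    + (((d : ℝ) + 1) * fr.ℓ₁ ^ 2 * fr.Kθ + fr.aplus * fr.ℓ₁ * fr.Kτ * (2 + fr.ℓ₁) + ((d : ℝ) + 1) * fr.ℓ₁ * fr.Kθ)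
      * fr.cI)

/-- `C68 ≥ 0` for `c ≥ 0`. [cite: Balaban1982Higgs2, (2.68) p. 572] -/
theorem C68_nonneg {c : ℝ} (hc : 0 ≤ c) : 0 ≤ fr.C68 c := by
  have := fr.hℓ₁; have := fr.Kτ_nonneg; have := fr.Kθ_nonneg; have := fr.cI_nonneg; have := fr.aplus_pos
  unfold C68; positivity

/-- the coefficient of `q` in (2.65) (`c` as in `C68`). [cite: Balaban1982Higgs2, (2.65) p. 572] -/
def C65 (c : ℝ) : ℝ :=
  fr.cO * fr.SO * (fr.K₅ + fr.K₄) + fr.C68 c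
    + (fr.aplus * (fr.kG * (fr.r₁ + fr.r₂ / fr.dG)) + fr.aplus * (fr.kG * fr.K₂) + fr.K₁) + fr.ℓ₁ * fr.Kτ

/-- the coefficient of `q` in (2.66) (`c, c₂` the uniform constants of the value / derivative remainders, `c′` that of
(2.17) at constant `A₀`). [cite: Balaban1982Higgs2, (2.66) p. 572] -/
def C66 (c c₂ c' : ℝ) : ℝ :=
  fr.cO * fr.SO * (fr.K₅ + fr.K₄) + (fr.aplus * (fr.kD * (fr.r₁ + fr.r₂ / fr.dD)) + fr.aplus * (fr.kD * fr.K₂))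
    + fr.ℓ₁ * fr.aplus * c' * fr.Kθ + (fr.C68 c₂ + fr.KD) + fr.ℓ₁ * fr.C68 c

/-- `C65 ≥ 0`. [cite: Balaban1982Higgs2, (2.65) p. 572] -/
theorem C65_nonneg {c : ℝ} (hc : 0 ≤ c) : 0 ≤ fr.C65 c := by
  have := fr.hℓ₁; have := fr.Kτ_nonneg; have := fr.K₁_nonneg; have := fr.K₂_nonneg; have := fr.K₄_nonneg
  have := fr.K₅_nonneg; have := fr.cO_nonneg; have := fr.SO_nonneg; have := fr.r₁_nonneg; have := fr.r₂_nonneg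
  have := fr.aplus_pos; have := fr.C68_nonneg hc
  have := (δG_spec d fr.ℓ fr.hℓ fr.amin fr.aplus fr.m2plus fr.ha).1
  have := (δG_spec d fr.ℓ fr.hℓ fr.amin fr.aplus fr.m2plus fr.ha).2.1
  unfold C65; positivity

/-- `C66 ≥ 0`. [cite: Balaban1982Higgs2, (2.66) p. 572] -/
theorem C66_nonneg {c c₂ c' : ℝ} (hc : 0 ≤ c) (hc₂ : 0 ≤ c₂) (hc' : 0 ≤ c') : 0 ≤ fr.C66 c c₂ c' := by
  have := fr.hℓ₁; have := fr.Kθ_nonneg; have := fr.KD_nonneg; have := fr.K₂_nonneg; have := fr.K₄_nonneg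
  have := fr.K₅_nonneg; have := fr.cO_nonneg; have := fr.SO_nonneg; have := fr.r₁_nonneg; have := fr.r₂_nonneg
  have := fr.aplus_pos; have := fr.C68_nonneg hc; have := fr.C68_nonneg hc₂
  have := (δD_spec d fr.ℓ fr.hℓ fr.amin fr.aplus fr.m2plus fr.ha).1
  have := (δD_spec d fr.ℓ fr.hℓ fr.amin fr.aplus fr.m2plus fr.ha).2.1
  unfold C66; positivity

end Frame

namespace Model

variable {d : ℕ} {fr : Frame ι d} {Yo : Type} [Fintype Yo] [DecidableEq Yo] (m : Model fr Yo)

/-- **PROPOSITION I.2.2, VALUES**: `‖g‖_∞ ≤ c_I·t_φ·q`. [cite: Balaban1982Higgs2, (2.68) p. 572 «Proposition I.2.2»] -/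
theorem supN_g_le (hR : m.Restr) : supN m.g ≤ fr.cI * (m.tφ * m.q) :=
  m.sup_g.trans (mul_le_mul_of_nonneg_left (m.supN_Ψ_le hR) fr.cI_nonneg)

/-- **PROPOSITION I.2.2, DERIVATIVES, IN THE `D^η_{A₀}` CONVENTION**: `Σ_μ‖D^η_{A₀,μ}g‖_∞ ≤ (d+1)c_I(1+ℓ₁)·t_φ·q`
(`D^η_{A₀} = D^η_{A^{(k)}} − (D^η_{A^{(k)}} − D^η_{A₀})`, the second of size `ℓ₁θ ≤ ℓ₁`).
[cite: Balaban1982Higgs2, (2.68) p. 572; Balaban1983RegularityDecay, p. 581] -/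
theorem sumD_le (hR : m.Restr) :
    ∑ μ, supN (derivA0 d fr.F m.κ fr.ℓ m.k m.M m.A₀ μ *ᵥ m.g) ≤ ((d : ℝ) + 1) * (fr.cI * (1 + fr.ℓ₁)) * (m.tφ * m.q) := by
  have hg := m.supN_g_le hR
  have htq : 0 ≤ m.tφ * m.q := mul_nonneg m.tφ_nonneg m.q_nonneg
  have hμ : ∀ μ, supN (derivA0 d fr.F m.κ fr.ℓ m.k m.M m.A₀ μ *ᵥ m.g) ≤ fr.cI * (1 + fr.ℓ₁) * (m.tφ * m.q) := by
    intro μ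
    have hsub := covDeriv_sub_supN_le_nbrs fr.F fr.hℓ₁ fr.hLip m.κ m.hn (constBond m.A₀ Subtype.val)
      (A' := m.A') m.hθ m.hA' μ m.g
    have hid : derivA0 d fr.F m.κ fr.ℓ m.k m.M m.A₀ μ *ᵥ m.g
        = derivA d fr.F m.κ fr.ℓ m.k m.M (constBond m.A₀ Subtype.val + m.A') μ *ᵥ m.g
          + -((derivA d fr.F m.κ fr.ℓ m.k m.M (constBond m.A₀ Subtype.val + m.A') μ
              - derivA0 d fr.F m.κ fr.ℓ m.k m.M m.A₀ μ) *ᵥ m.g) := by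
      rw [sub_mulVec]; abel
    rw [hid]
    refine (supN_add_le _ _).trans ?_
    rw [supN_neg]
    have h1 := m.sup_Dg μ
    have h2 : supN m.Ψ ≤ m.tφ * m.q := m.supN_Ψ_le hR
    have h3 : fr.ℓ₁ * m.θ * supN m.g ≤ fr.ℓ₁ * (fr.cI * (m.tφ * m.q)) := by
      calc fr.ℓ₁ * m.θ * supN m.g ≤ fr.ℓ₁ * 1 * supN m.g :=
            mul_le_mul_of_nonneg_right (mul_le_mul_of_nonneg_left m.hθ1 fr.hℓ₁) (supN_nonneg _)
        _ ≤ fr.ℓ₁ * (fr.cI * (m.tφ * m.q)) := by rw [mul_one]; exact mul_le_mul_of_nonneg_left hg fr.hℓ₁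
    have h4 : fr.cI * supN m.Ψ ≤ fr.cI * (m.tφ * m.q) := mul_le_mul_of_nonneg_left h2 fr.cI_nonneg
    calc supN (derivA d fr.F m.κ fr.ℓ m.k m.M (constBond m.A₀ Subtype.val + m.A') μ *ᵥ m.g)
          + supN ((derivA d fr.F m.κ fr.ℓ m.k m.M (constBond m.A₀ Subtype.val + m.A') μ
              - derivA0 d fr.F m.κ fr.ℓ m.k m.M m.A₀ μ) *ᵥ m.g)
        ≤ fr.cI * (m.tφ * m.q) + fr.ℓ₁ * (fr.cI * (m.tφ * m.q)) := add_le_add (h1.trans h4) (hsub.trans h3)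
      _ = fr.cI * (1 + fr.ℓ₁) * (m.tφ * m.q) := by ring
  calc ∑ μ, supN (derivA0 d fr.F m.κ fr.ℓ m.k m.M m.A₀ μ *ᵥ m.g)
      ≤ ∑ _μ : Fin (d + 1), fr.cI * (1 + fr.ℓ₁) * (m.tφ * m.q) := sum_le_sum fun μ _ => hμ μ
    _ = ((d : ℝ) + 1) * (fr.cI * (1 + fr.ℓ₁)) * (m.tφ * m.q) := by rw [sum_const_dir']; ring

/-- **THE SCALE BOOKKEEPING OF THE (2.68) REMAINDER** («= … + O((L^kε)^{κ₀})»): a quantity bounded by the right-hand side of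
`remainder268_sup` / `remainder268_deriv_site` is `≤ C68·q`, by Proposition I.2.2 (`supN_g_le`, `sumD_le`), the
restriction (2.55)₄ and the scale hypotheses `θt_φ ≤ Kθ`, `τt_φ ≤ Kτ`, `θ, τ ≤ 1`, `a_k ≤ a₊`.
[cite: Balaban1982Higgs2, (2.68) p. 572] -/
theorem rem_arith (hR : m.Restr) {c E : ℝ} (hc : 0 ≤ c)
    (hE : E ≤ c * (B1.aSeq m.a ((fr.ℓ : ℝ) + 1) m.k * (fr.ℓ₁ * m.τ)) * supN m.Ψ
      + c * (((d : ℝ) + 1) * fr.ℓ₁ * m.θ) * ∑ μ, supN (derivA0 d fr.F m.κ fr.ℓ m.k m.M m.A₀ μ *ᵥ m.g)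
      + c * (((d : ℝ) + 1) * fr.ℓ₁ ^ 2 * m.θ ^ 2 + B1.aSeq m.a ((fr.ℓ : ℝ) + 1) m.k * (fr.ℓ₁ * m.τ * (2 + fr.ℓ₁ * m.τ))
          + ((d : ℝ) + 1) * fr.ℓ₁ * m.θ) * supN m.g) :
    E ≤ fr.C68 c * m.q := by
  have hq := m.q_nonneg; have ht := m.tφ_nonneg; have hℓ₁ := fr.hℓ₁; have hθ := m.hθ; have hτ := m.hτ
  have hcI := fr.cI_nonneg; have hKθ := fr.Kθ_nonneg; have hKτ := fr.Kτ_nonneg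
  have hap := fr.aplus_pos.le; have hak := m.hak.le; have hakle := m.hakle
  have hΨ := m.supN_Ψ_le hR; have hg := m.supN_g_le hR; have hS := m.sumD_le hR
  set ak := B1.aSeq m.a ((fr.ℓ : ℝ) + 1) m.k with hakdef
  -- the three scale products
  have u1 : m.θ * m.tφ ≤ fr.Kθ := m.θ_scale
  have u2 : m.τ * m.tφ ≤ fr.Kτ := m.τ_scale
  have u3 : m.θ ^ 2 * m.tφ ≤ fr.Kθ := by
    calc m.θ ^ 2 * m.tφ = m.θ * (m.θ * m.tφ) := by ring
      _ ≤ 1 * fr.Kθ := mul_le_mul m.hθ1 u1 (mul_nonneg hθ ht) zero_le_one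
      _ = fr.Kθ := one_mul _
  -- term 1
  have T1 : c * (ak * (fr.ℓ₁ * m.τ)) * supN m.Ψ ≤ c * (fr.aplus * fr.ℓ₁ * fr.Kτ) * m.q := by
    calc c * (ak * (fr.ℓ₁ * m.τ)) * supN m.Ψ ≤ c * (ak * (fr.ℓ₁ * m.τ)) * (m.tφ * m.q) :=
          mul_le_mul_of_nonneg_left hΨ (by positivity)
      _ = (c * ak * fr.ℓ₁) * m.τ * (m.tφ * m.q) := by ring
      _ ≤ (c * ak * fr.ℓ₁) * fr.Kτ * m.q := scale_le (by positivity) hq u2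
      _ ≤ (c * fr.aplus * fr.ℓ₁) * fr.Kτ * m.q := by
          have : c * ak * fr.ℓ₁ ≤ c * fr.aplus * fr.ℓ₁ :=
            mul_le_mul_of_nonneg_right (mul_le_mul_of_nonneg_left hakle hc) hℓ₁
          exact mul_le_mul_of_nonneg_right (mul_le_mul_of_nonneg_right this hKτ) hq
      _ = c * (fr.aplus * fr.ℓ₁ * fr.Kτ) * m.q := by ring
  -- term 2
  have T2 : c * (((d : ℝ) + 1) * fr.ℓ₁ * m.θ) * ∑ μ, supN (derivA0 d fr.F m.κ fr.ℓ m.k m.M m.A₀ μ *ᵥ m.g)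
      ≤ c * (((d : ℝ) + 1) * fr.ℓ₁ * fr.Kθ * (((d : ℝ) + 1) * (fr.cI * (1 + fr.ℓ₁)))) * m.q := by
    calc c * (((d : ℝ) + 1) * fr.ℓ₁ * m.θ) * ∑ μ, supN (derivA0 d fr.F m.κ fr.ℓ m.k m.M m.A₀ μ *ᵥ m.g)
        ≤ c * (((d : ℝ) + 1) * fr.ℓ₁ * m.θ) * (((d : ℝ) + 1) * (fr.cI * (1 + fr.ℓ₁)) * (m.tφ * m.q)) :=
          mul_le_mul_of_nonneg_left hS (by positivity)
      _ = (c * (((d : ℝ) + 1) * fr.ℓ₁) * (((d : ℝ) + 1) * (fr.cI * (1 + fr.ℓ₁)))) * m.θ * (m.tφ * m.q) := by ring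
      _ ≤ (c * (((d : ℝ) + 1) * fr.ℓ₁) * (((d : ℝ) + 1) * (fr.cI * (1 + fr.ℓ₁)))) * fr.Kθ * m.q :=
          scale_le (by positivity) hq u1
      _ = _ := by ring
  -- term 3
  have T3 : c * (((d : ℝ) + 1) * fr.ℓ₁ ^ 2 * m.θ ^ 2 + ak * (fr.ℓ₁ * m.τ * (2 + fr.ℓ₁ * m.τ))
        + ((d : ℝ) + 1) * fr.ℓ₁ * m.θ) * supN m.g
      ≤ c * ((((d : ℝ) + 1) * fr.ℓ₁ ^ 2 * fr.Kθ + fr.aplus * fr.ℓ₁ * fr.Kτ * (2 + fr.ℓ₁)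
        + ((d : ℝ) + 1) * fr.ℓ₁ * fr.Kθ) * fr.cI) * m.q := by
    have h0 : 0 ≤ ((d : ℝ) + 1) * fr.ℓ₁ ^ 2 * m.θ ^ 2 + ak * (fr.ℓ₁ * m.τ * (2 + fr.ℓ₁ * m.τ))
        + ((d : ℝ) + 1) * fr.ℓ₁ * m.θ := by positivity
    have s1 : ((d : ℝ) + 1) * fr.ℓ₁ ^ 2 * m.θ ^ 2 * (m.tφ * m.q) ≤ ((d : ℝ) + 1) * fr.ℓ₁ ^ 2 * fr.Kθ * m.q :=
      scale_le (by positivity) hq u3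
    have s2 : ak * (fr.ℓ₁ * m.τ * (2 + fr.ℓ₁ * m.τ)) * (m.tφ * m.q) ≤ fr.aplus * fr.ℓ₁ * fr.Kτ * (2 + fr.ℓ₁) * m.q := by
      have h22 : 2 + fr.ℓ₁ * m.τ ≤ 2 + fr.ℓ₁ := by nlinarith [m.hτ1]
      calc ak * (fr.ℓ₁ * m.τ * (2 + fr.ℓ₁ * m.τ)) * (m.tφ * m.q)
          = (ak * fr.ℓ₁ * (2 + fr.ℓ₁ * m.τ)) * m.τ * (m.tφ * m.q) := by ring
        _ ≤ (ak * fr.ℓ₁ * (2 + fr.ℓ₁ * m.τ)) * fr.Kτ * m.q := scale_le (by positivity) hq u2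
        _ ≤ (fr.aplus * fr.ℓ₁ * (2 + fr.ℓ₁)) * fr.Kτ * m.q := by
            have : ak * fr.ℓ₁ * (2 + fr.ℓ₁ * m.τ) ≤ fr.aplus * fr.ℓ₁ * (2 + fr.ℓ₁) :=
              mul_le_mul (mul_le_mul_of_nonneg_right hakle hℓ₁) h22 (by positivity) (by positivity)
            exact mul_le_mul_of_nonneg_right (mul_le_mul_of_nonneg_right this hKτ) hq
        _ = fr.aplus * fr.ℓ₁ * fr.Kτ * (2 + fr.ℓ₁) * m.q := by ring
    have s3 : ((d : ℝ) + 1) * fr.ℓ₁ * m.θ * (m.tφ * m.q) ≤ ((d : ℝ) + 1) * fr.ℓ₁ * fr.Kθ * m.q :=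
      scale_le (by positivity) hq u1
    calc c * (((d : ℝ) + 1) * fr.ℓ₁ ^ 2 * m.θ ^ 2 + ak * (fr.ℓ₁ * m.τ * (2 + fr.ℓ₁ * m.τ))
            + ((d : ℝ) + 1) * fr.ℓ₁ * m.θ) * supN m.g
        ≤ c * (((d : ℝ) + 1) * fr.ℓ₁ ^ 2 * m.θ ^ 2 + ak * (fr.ℓ₁ * m.τ * (2 + fr.ℓ₁ * m.τ))
            + ((d : ℝ) + 1) * fr.ℓ₁ * m.θ) * (fr.cI * (m.tφ * m.q)) :=
          mul_le_mul_of_nonneg_left hg (mul_nonneg hc h0)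
      _ = c * fr.cI * (((d : ℝ) + 1) * fr.ℓ₁ ^ 2 * m.θ ^ 2 * (m.tφ * m.q)
            + ak * (fr.ℓ₁ * m.τ * (2 + fr.ℓ₁ * m.τ)) * (m.tφ * m.q)
            + ((d : ℝ) + 1) * fr.ℓ₁ * m.θ * (m.tφ * m.q)) := by ring
      _ ≤ c * fr.cI * (((d : ℝ) + 1) * fr.ℓ₁ ^ 2 * fr.Kθ * m.q + fr.aplus * fr.ℓ₁ * fr.Kτ * (2 + fr.ℓ₁) * m.q
            + ((d : ℝ) + 1) * fr.ℓ₁ * fr.Kθ * m.q) :=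
          mul_le_mul_of_nonneg_left (add_le_add (add_le_add s1 s2) s3) (mul_nonneg hc hcI)
      _ = _ := by ring
  refine hE.trans ?_
  refine (add_le_add (add_le_add T1 T2) T3).trans (le_of_eq ?_)
  unfold Frame.C68
  ring

end Model

end Assembly

/-! ## §9 (2.65) and (2.66) pointwise; the row's decl of record for the model family -/

section Final

namespace Model

variable {d : ℕ} {fr : Frame ι d} {Yo : Type} [Fintype Yo] [DecidableEq Yo] (m : Model fr Yo)

/-- **(2.65) AT A POINT OF `B^k(y)`** — «Combining the equalities (2.67), (2.68), (2.74), (2.76) and taking into account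
the equalities φ′(y) = φ(y), U(A₀(Γ_{x,y}))φ(y) = U(A^{(k)}(Γ^{(k)}_{x,y}))φ(y) + O((L^kε)^{κ₀}) we finally get (2.65)»:
`|φ^{(k)}(x) − U(A^{(k)}(Γ^{(k)}_{x,y}))φ(y)| ≤ C65·q`, `q = p(L^{k−1}ε)`. [cite: Balaban1982Higgs2, (2.65) p. 572, p. 573] -/
theorem value_site_le (hR : m.Restr) {c : ℝ} (hc : 0 ≤ c)
    (hrem : supN (m.g - m.main) ≤ c * (B1.aSeq m.a ((fr.ℓ : ℝ) + 1) m.k * (fr.ℓ₁ * m.τ)) * supN m.Ψ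
      + c * (((d : ℝ) + 1) * fr.ℓ₁ * m.θ) * ∑ μ, supN (derivA0 d fr.F m.κ fr.ℓ m.k m.M m.A₀ μ *ᵥ m.g)
      + c * (((d : ℝ) + 1) * fr.ℓ₁ ^ 2 * m.θ ^ 2 + B1.aSeq m.a ((fr.ℓ : ℝ) + 1) m.k * (fr.ℓ₁ * m.τ * (2 + fr.ℓ₁ * m.τ))
          + ((d : ℝ) + 1) * fr.ℓ₁ * m.θ) * supN m.g)
    (x : ↥(Box d fr.ℓ m.k m.M)) (hx : blkSite d fr.ℓ m.k m.M x = m.y) :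
    siteNorm (m.φk x - m.target x) ≤ fr.C65 c * m.q := by
  have h1 := m.loc267_site hR x hx
  have h2 : siteNorm (fld m.g x - fld m.main x) ≤ fr.C68 c * m.q :=
    (le_supN (m.g - m.main) x).trans (m.rem_arith hR hc hrem)
  have h3 := m.main_site_le hR x hx
  have h4 := m.target_site_le hR x hx
  have hsplit : m.φk x - m.target x = (m.φk x - fld m.g x) + (fld m.g x - fld m.main x)
      + (fld m.main x - gaugeU d fr.F m.κ fr.ℓ m.k m.M m.A₀ x *ᵥ fld m.φ' m.y)
      + (gaugeU d fr.F m.κ fr.ℓ m.k m.M m.A₀ x *ᵥ fld m.φ' m.y - m.target x) := by abel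
  rw [hsplit]
  refine ((siteNorm_add_le _ _).trans (add_le_add ((siteNorm_add_le _ _).trans (add_le_add
    ((siteNorm_add_le _ _).trans (add_le_add h1 h2)) h3)) h4)).trans (le_of_eq ?_)
  unfold Frame.C65
  ring

/-- the two right-hand sides of (2.65) coincide in the lineage (weight-1 adjoint block average).
[cite: Balaban1982Higgs2, (2.65) p. 572] -/
theorem QsA_eq_target (x : ↥(Box d fr.ℓ m.k m.M)) (hx : blkSite d fr.ℓ m.k m.M x = m.y) :
    fld ((avgA d fr.F m.κ fr.ℓ m.k m.M m.emb m.Γ (constBond m.A₀ Subtype.val + m.A'))ᵀ *ᵥ m.Ψ) x = m.target x := by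
  rw [fld_avgA_transpose, hx, m.fld_Ψ_of_mem m.y_mem]

/-- **(2.66) AT A BOND `b = (x, x+e_μ) ⊂ □`, `x ∈ B^k(y)`**: `|(D^η_{A^{(k)}}φ^{(k)})(b)| ≤ C66·q` — (2.67)′, the derivative of
(2.68) (remainder pieces + the input `remD`), (2.77) through the gauge (`deriv_main_gauge`, `eq277_site`), and the
`D_{A^{(k)}} ↔ D_{A₀}` conversions (size `ℓ₁θ`). [cite: Balaban1982Higgs2, (2.66) p. 572, (2.77) p. 573, p. 574 l. 1–2] -/
theorem deriv_site_le (hR : m.Restr) {c c₂ c' : ℝ} (hc : 0 ≤ c) (hc₂ : 0 ≤ c₂) (hc' : 0 ≤ c')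
    (hrem : supN (m.g - m.main) ≤ c * (B1.aSeq m.a ((fr.ℓ : ℝ) + 1) m.k * (fr.ℓ₁ * m.τ)) * supN m.Ψ
      + c * (((d : ℝ) + 1) * fr.ℓ₁ * m.θ) * ∑ μ, supN (derivA0 d fr.F m.κ fr.ℓ m.k m.M m.A₀ μ *ᵥ m.g)
      + c * (((d : ℝ) + 1) * fr.ℓ₁ ^ 2 * m.θ ^ 2 + B1.aSeq m.a ((fr.ℓ : ℝ) + 1) m.k * (fr.ℓ₁ * m.τ * (2 + fr.ℓ₁ * m.τ))
          + ((d : ℝ) + 1) * fr.ℓ₁ * m.θ) * supN m.g)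
    (hremD : ∀ (ν : Fin (d + 1)) (x : ↥(Box d fr.ℓ m.k m.M)),
      siteNorm (fld (derivA0 d fr.F m.κ fr.ℓ m.k m.M m.A₀ ν *ᵥ (m.g - m.main)) x)
        ≤ c₂ * (B1.aSeq m.a ((fr.ℓ : ℝ) + 1) m.k * (fr.ℓ₁ * m.τ)) * supN m.Ψ
          + c₂ * (((d : ℝ) + 1) * fr.ℓ₁ * m.θ) * ∑ μ, supN (derivA0 d fr.F m.κ fr.ℓ m.k m.M m.A₀ μ *ᵥ m.g)
          + c₂ * (((d : ℝ) + 1) * fr.ℓ₁ ^ 2 * m.θ ^ 2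
              + B1.aSeq m.a ((fr.ℓ : ℝ) + 1) m.k * (fr.ℓ₁ * m.τ * (2 + fr.ℓ₁ * m.τ))) * supN m.g
          + siteNorm (fld (derivA0 d fr.F m.κ fr.ℓ m.k m.M m.A₀ ν *ᵥ (greenA0 d fr.F m.κ fr.ℓ m.k m.a m.m2 m.M m.emb
              m.Γ m.A₀ *ᵥ (B4Lower18Regular.crossOp (boxWt ((fr.ℓ + 1) ^ m.k) fun i => (fr.ℓ + 1) ^ m.k * m.M i)
                (fieldLink fr.F m.κ (constBond m.A₀ Subtype.val)) (B4Lower18Regular.pertE (fieldLink fr.F m.κ m.A'))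
                  *ᵥ m.g))) x))
    (hcb : ∀ Φ : ↥(Box d fr.ℓ m.k m.M) × ι → ℝ,
      supN (greenA0 d fr.F m.κ fr.ℓ m.k m.a m.m2 m.M m.emb m.Γ m.A₀ *ᵥ Φ) ≤ c' * supN Φ)
    (μ : Fin (d + 1)) (x : ↥(Box d fr.ℓ m.k m.M)) (hx : blkSite d fr.ℓ m.k m.M x = m.y)
    (h : x.1 + e1 μ ∈ Box d fr.ℓ m.k m.M) :
    siteNorm (m.dφk μ x h) ≤ fr.C66 c c₂ c' * m.q := by
  have hq := m.q_nonneg; have ht := m.tφ_nonneg; have hℓ₁ := fr.hℓ₁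
  have hA'μ : ∀ x y : ↥(Box d fr.ℓ m.k m.M), y.1 = x.1 + e1 μ → |m.κ * m.A' x y| ≤ m.θ / ((fr.ℓ + 1) ^ m.k : ℕ) :=
    fun x y hy => m.hA' x y (hy ▸ B4Lemma22ReduceDeriv.add_e1_mem_nbrs x.1 μ)
  set D := derivA d fr.F m.κ fr.ℓ m.k m.M (constBond m.A₀ Subtype.val + m.A') μ with hDdef
  set D₀ := derivA0 d fr.F m.κ fr.ℓ m.k m.M m.A₀ μ with hD₀def
  -- (2.67)′
  have h1 := m.dloc267_site hR μ x hx h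
  -- the decomposition `D g = D₀ main + (D − D₀) main + D₀(g − main) + (D − D₀)(g − main)`
  have hsplit : fld (D *ᵥ m.g) x = fld (D₀ *ᵥ m.main) x + fld ((D - D₀) *ᵥ m.main) x
      + fld (D₀ *ᵥ (m.g - m.main)) x + fld ((D - D₀) *ᵥ (m.g - m.main)) x := by
    have : D *ᵥ m.g = D₀ *ᵥ m.main + (D - D₀) *ᵥ m.main + D₀ *ᵥ (m.g - m.main) + (D - D₀) *ᵥ (m.g - m.main) := by
      simp only [sub_mulVec, mulVec_sub]; abel
    rw [this]; rfl
  -- (2.77): the gauged main term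
  have h2 : siteNorm (fld (D₀ *ᵥ m.main) x)
      ≤ (fr.aplus * (fr.kD * (fr.r₁ + fr.r₂ / fr.dD)) + fr.aplus * (fr.kD * fr.K₂)) * m.q := by
    have hg := deriv_main_gauge fr.F m.κ fr.hℓ m.hk m.ha' m.hm1 m.hM m.hend m.A₀ (B1.aSeq m.a ((fr.ℓ : ℝ) + 1) m.k)
      m.Ψ μ
    rw [hD₀def]
    dsimp only [Model.main]
    rw [hg, fld_blockDiag_mulVec]
    dsimp only [gaugeU]
    rw [siteNorm_flow]
    have h77 := eq277_site (ι := ι) fr.hℓ m.hk fr.ha m.ha1 m.ha2 m.hm1 m.hm2 m.hM m.sq1 m.y m.φ'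
      (fun y' hy' => m.fld_φ'_of_not_mem hy') m.q_nonneg fr.r₁_nonneg fr.r₂_nonneg (m.siteNorm_fld_φ'_y hR) μ x h
      (m.lip_φ' hR x hx) (m.far1 x hx)
    refine h77.trans ?_
    have hkD : 0 ≤ fr.kD := (δD_spec d fr.ℓ fr.hℓ fr.amin fr.aplus fr.m2plus fr.ha).2.1.le
    have : Real.exp (-(fr.dD * m.R₁)) * fr.kD * m.tφ ≤ fr.kD * fr.K₂ := by
      calc Real.exp (-(fr.dD * m.R₁)) * fr.kD * m.tφ = fr.kD * (Real.exp (-(fr.dD * m.R₁)) * m.tφ) := by ring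
        _ ≤ fr.kD * fr.K₂ := mul_le_mul_of_nonneg_left m.sepD hkD
    have e1 := mul_le_mul_of_nonneg_right (mul_le_mul_of_nonneg_left this fr.aplus_pos.le) hq
    linarith
  -- `(D − D₀) main`
  have h3 : siteNorm (fld ((D - D₀) *ᵥ m.main) x) ≤ fr.ℓ₁ * fr.aplus * c' * fr.Kθ * m.q := by
    have hsub := B4Lemma22ReduceDeriv.covDeriv_sub_siteNorm_le fr.F fr.hℓ₁ fr.hLip m.κ m.hn
      (constBond m.A₀ Subtype.val) (A' := m.A') m.hθ hA'μ m.main x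
    have hmain : supN m.main ≤ fr.aplus * c' * (m.tφ * m.q) := by
      dsimp only [Model.main]
      refine (supN_smul_le _ _).trans ?_
      rw [abs_of_pos m.hak]
      have h5 : supN ((avgA d fr.F m.κ fr.ℓ m.k m.M m.emb m.Γ (constBond m.A₀ Subtype.val))ᵀ *ᵥ m.Ψ) ≤ supN m.Ψ :=
        supN_le (supN_nonneg _) fun x' =>
          B4Lemma22PertVSup.avgT_site fr.F m.κ m.M m.emb m.Γ (constBond m.A₀ Subtype.val) m.Ψ x'
      calc B1.aSeq m.a ((fr.ℓ : ℝ) + 1) m.k * supN (greenA0 d fr.F m.κ fr.ℓ m.k m.a m.m2 m.M m.emb m.Γ m.A₀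
            *ᵥ ((avgA d fr.F m.κ fr.ℓ m.k m.M m.emb m.Γ (constBond m.A₀ Subtype.val))ᵀ *ᵥ m.Ψ))
          ≤ fr.aplus * (c' * (m.tφ * m.q)) :=
            mul_le_mul m.hakle ((hcb _).trans (mul_le_mul_of_nonneg_left (h5.trans (m.supN_Ψ_le hR)) hc'))
              (supN_nonneg _) fr.aplus_pos.le
        _ = fr.aplus * c' * (m.tφ * m.q) := by ring
    calc siteNorm (fld ((D - D₀) *ᵥ m.main) x) ≤ fr.ℓ₁ * m.θ * supN m.main := hsub
      _ ≤ fr.ℓ₁ * m.θ * (fr.aplus * c' * (m.tφ * m.q)) := mul_le_mul_of_nonneg_left hmain (mul_nonneg hℓ₁ m.hθ)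
      _ = (fr.ℓ₁ * fr.aplus * c') * m.θ * (m.tφ * m.q) := by ring
      _ ≤ (fr.ℓ₁ * fr.aplus * c') * fr.Kθ * m.q :=
          scale_le (mul_nonneg (mul_nonneg hℓ₁ fr.aplus_pos.le) hc') hq m.θ_scale
      _ = _ := by ring
  -- `D₀(g − main)`: the derivative of the (2.68) remainder, with the input `remD` for its divergence-form piece
  have h4 : siteNorm (fld (D₀ *ᵥ (m.g - m.main)) x) ≤ (fr.C68 c₂ + fr.KD) * m.q := by
    have hE := hremD μ x
    have hED := (m.remD μ x hx).trans m.ED_le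
    have hg0 : 0 ≤ c₂ * (((d : ℝ) + 1) * fr.ℓ₁ * m.θ) * supN m.g := by
      have := supN_nonneg m.g; have := m.hθ; positivity
    have key := m.rem_arith hR hc₂ (E := siteNorm (fld (D₀ *ᵥ (m.g - m.main)) x) - fr.KD * m.q) (by
      rw [hD₀def]; nlinarith [hE, hED, hg0])
    linarith
  -- `(D − D₀)(g − main)`
  have h5 : siteNorm (fld ((D - D₀) *ᵥ (m.g - m.main)) x) ≤ fr.ℓ₁ * fr.C68 c * m.q := by
    have hsub := B4Lemma22ReduceDeriv.covDeriv_sub_siteNorm_le fr.F fr.hℓ₁ fr.hLip m.κ m.hn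
      (constBond m.A₀ Subtype.val) (A' := m.A') m.hθ hA'μ (m.g - m.main) x
    have hr := m.rem_arith hR hc hrem
    have hC := fr.C68_nonneg hc
    calc siteNorm (fld ((D - D₀) *ᵥ (m.g - m.main)) x) ≤ fr.ℓ₁ * m.θ * supN (m.g - m.main) := hsub
      _ ≤ fr.ℓ₁ * 1 * (fr.C68 c * m.q) :=
          mul_le_mul (mul_le_mul_of_nonneg_left m.hθ1 hℓ₁) hr (supN_nonneg _) (by positivity)
      _ = fr.ℓ₁ * fr.C68 c * m.q := by ring
  have hfin : siteNorm (m.dφk μ x h) ≤ siteNorm (m.dφk μ x h - fld (D *ᵥ m.g) x) + siteNorm (fld (D *ᵥ m.g) x) := by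
    have := siteNorm_add_le (m.dφk μ x h - fld (D *ᵥ m.g) x) (fld (D *ᵥ m.g) x)
    rwa [sub_add_cancel] at this
  have h6 : siteNorm (fld (D *ᵥ m.g) x)
      ≤ (fr.aplus * (fr.kD * (fr.r₁ + fr.r₂ / fr.dD)) + fr.aplus * (fr.kD * fr.K₂)) * m.q
        + fr.ℓ₁ * fr.aplus * c' * fr.Kθ * m.q + (fr.C68 c₂ + fr.KD) * m.q + fr.ℓ₁ * fr.C68 c * m.q := by
    rw [hsplit]
    exact (siteNorm_add_le _ _).trans (add_le_add ((siteNorm_add_le _ _).trans (add_le_add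
      ((siteNorm_add_le _ _).trans (add_le_add h2 h3)) h4)) h5)
  refine (hfin.trans (add_le_add h1 h6)).trans (le_of_eq ?_)
  unfold Frame.C66
  ring

/-- the suprema over `B^k(y)`. [cite: Balaban1982Higgs2, (2.65)–(2.66) p. 572] -/
theorem dev_le (hR : m.Restr) {c c₂ c' : ℝ} (hc : 0 ≤ c) (hc₂ : 0 ≤ c₂) (hc' : 0 ≤ c')
    (hrem : supN (m.g - m.main) ≤ c * (B1.aSeq m.a ((fr.ℓ : ℝ) + 1) m.k * (fr.ℓ₁ * m.τ)) * supN m.Ψ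
      + c * (((d : ℝ) + 1) * fr.ℓ₁ * m.θ) * ∑ μ, supN (derivA0 d fr.F m.κ fr.ℓ m.k m.M m.A₀ μ *ᵥ m.g)
      + c * (((d : ℝ) + 1) * fr.ℓ₁ ^ 2 * m.θ ^ 2 + B1.aSeq m.a ((fr.ℓ : ℝ) + 1) m.k * (fr.ℓ₁ * m.τ * (2 + fr.ℓ₁ * m.τ))
          + ((d : ℝ) + 1) * fr.ℓ₁ * m.θ) * supN m.g)
    (hremD : ∀ (ν : Fin (d + 1)) (x : ↥(Box d fr.ℓ m.k m.M)),
      siteNorm (fld (derivA0 d fr.F m.κ fr.ℓ m.k m.M m.A₀ ν *ᵥ (m.g - m.main)) x)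
        ≤ c₂ * (B1.aSeq m.a ((fr.ℓ : ℝ) + 1) m.k * (fr.ℓ₁ * m.τ)) * supN m.Ψ
          + c₂ * (((d : ℝ) + 1) * fr.ℓ₁ * m.θ) * ∑ μ, supN (derivA0 d fr.F m.κ fr.ℓ m.k m.M m.A₀ μ *ᵥ m.g)
          + c₂ * (((d : ℝ) + 1) * fr.ℓ₁ ^ 2 * m.θ ^ 2
              + B1.aSeq m.a ((fr.ℓ : ℝ) + 1) m.k * (fr.ℓ₁ * m.τ * (2 + fr.ℓ₁ * m.τ))) * supN m.g
          + siteNorm (fld (derivA0 d fr.F m.κ fr.ℓ m.k m.M m.A₀ ν *ᵥ (greenA0 d fr.F m.κ fr.ℓ m.k m.a m.m2 m.M m.emb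
              m.Γ m.A₀ *ᵥ (B4Lower18Regular.crossOp (boxWt ((fr.ℓ + 1) ^ m.k) fun i => (fr.ℓ + 1) ^ m.k * m.M i)
                (fieldLink fr.F m.κ (constBond m.A₀ Subtype.val)) (B4Lower18Regular.pertE (fieldLink fr.F m.κ m.A'))
                  *ᵥ m.g))) x))
    (hcb : ∀ Φ : ↥(Box d fr.ℓ m.k m.M) × ι → ℝ,
      supN (greenA0 d fr.F m.κ fr.ℓ m.k m.a m.m2 m.M m.emb m.Γ m.A₀ *ᵥ Φ) ≤ c' * supN Φ) :
    m.dev265a ≤ fr.C65 c * m.q ∧ m.dev265b ≤ fr.C65 c * m.q ∧ m.dev266 ≤ fr.C66 c c₂ c' * m.q := by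
  have h65 : 0 ≤ fr.C65 c * m.q := mul_nonneg (fr.C65_nonneg hc) m.q_nonneg
  have h66 : 0 ≤ fr.C66 c c₂ c' * m.q := mul_nonneg (fr.C66_nonneg hc hc₂ hc') m.q_nonneg
  refine ⟨Real.iSup_le (fun x => m.value_site_le hR hc hrem x.1 x.2) h65,
    Real.iSup_le (fun x => ?_) h65, Real.iSup_le (fun b => m.deriv_site_le hR hc hc₂ hc' hrem hremD hcb _ _ b.2.1 b.2.2) h66⟩
  rw [m.QsA_eq_target x.1 x.2]
  exact m.value_site_le hR hc hrem x.1 x.2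

end Model

/-- **LEMMA 2.4 FOR THE MODEL FAMILY, WITH AN EXPLICIT UNIFORM CONSTANT**: for every frame there is `C ≥ 0` such that
every instance obeying the restrictions has `dev265a, dev265b, dev266 ≤ C·p(L^kε)`.
[cite: Balaban1982Higgs2, Lemma 2.4 (2.65)–(2.66) p. 572] -/
theorem lemma24_bounds {d : ℕ} (fr : Frame ι d) :
    ∃ C : ℝ, 0 ≤ C ∧ ∀ (Yo : Type) [Fintype Yo] [DecidableEq Yo] (m : Model fr Yo), m.Restr →
      m.dev265a ≤ C * m.p ∧ m.dev265b ≤ C * m.p ∧ m.dev266 ≤ C * m.p := by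
  obtain ⟨c, hc, hrem⟩ := remainder268_sup fr.F fr.hℓ₁ fr.hLip d fr.ℓ fr.hℓ fr.amin fr.aplus fr.m2plus fr.ha
  obtain ⟨c₂, hc₂, hremD⟩ :=
    remainder268_deriv_site fr.F fr.hℓ₁ fr.hLip d fr.ℓ fr.hℓ fr.amin fr.aplus fr.m2plus fr.ha
  obtain ⟨c', hc', hcb⟩ := const_box_unif fr.F d fr.ℓ fr.hℓ fr.amin fr.aplus fr.m2plus fr.ha
  have hC65 := fr.C65_nonneg hc.le
  have hC66 := fr.C66_nonneg hc.le hc₂.le hc'.le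
  refine ⟨fr.K₃ * (fr.C65 c + fr.C66 c c₂ c'), mul_nonneg fr.K₃_nonneg (add_nonneg hC65 hC66), ?_⟩
  intro Yo _ _ m hR
  have hremm := hrem m.κ m.k m.hk m.a m.m2 m.ha1 m.ha2 m.hm1 m.hm2 m.M m.hM m.emb m.Γ m.hend m.A₀ m.A' m.θ m.τ
    m.hunit m.hθ m.hA' m.hτ m.hτA m.Ψ
  have hremDm := hremD m.κ m.k m.hk m.a m.m2 m.ha1 m.ha2 m.hm1 m.hm2 m.M m.hM m.emb m.Γ m.hend m.A₀ m.A' m.θ m.τ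
    m.hunit m.hθ m.hA' m.hτ m.hτA m.Ψ
  obtain ⟨hcb0, -, -, -⟩ := hcb m.κ m.k m.hk m.a m.m2 m.ha1 m.ha2 m.hm1 m.hm2 m.M m.hM m.emb m.Γ m.hend m.A₀
  obtain ⟨h1, h2, h3⟩ := m.dev_le hR hc.le hc₂.le hc'.le hremm hremDm hcb0
  have hq : m.q ≤ fr.K₃ * m.p := m.q_le
  have hK3p : 0 ≤ fr.K₃ * m.p := mul_nonneg fr.K₃_nonneg m.p_nonneg
  have e65 : fr.C65 c * m.q ≤ fr.K₃ * (fr.C65 c + fr.C66 c c₂ c') * m.p := by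
    have h1 := mul_le_mul_of_nonneg_left hq hC65
    have h2 : 0 ≤ fr.C66 c c₂ c' * (fr.K₃ * m.p) := mul_nonneg hC66 hK3p
    linarith
  have e66 : fr.C66 c c₂ c' * m.q ≤ fr.K₃ * (fr.C65 c + fr.C66 c c₂ c') * m.p := by
    have h1 := mul_le_mul_of_nonneg_left hq hC66
    have h2 : 0 ≤ fr.C65 c * (fr.K₃ * m.p) := mul_nonneg hC65 hK3p
    linarith
  exact ⟨h1.trans e65, h2.trans e65, h3.trans e66⟩

/-! ### Row B2.Lem2.4: the decl of record for the model family -/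

/-- the row's carrier filled by an instance: `p` ↤ `p(L^kε)`, `restr255` ↤ `Model.Restr`, the three printed suprema.
[cite: Balaban1982Higgs2, Lemma 2.4 p. 572] -/
noncomputable def famOf {d : ℕ} (fr : Frame ι d) (Yo : Type) [Fintype Yo] [DecidableEq Yo] (m : Model fr Yo) :
    B2.L24Setting where
  p := m.p
  restr255 := m.Restr
  dev265a := m.dev265a
  dev265b := m.dev265b
  dev266 := m.dev266

/-- **ROW B2.Lem2.4 — [Balaban1982Higgs2] LEMMA 2.4 (2.65)–(2.66), THE DECL OF RECORD `B2.Lemma24Printed`, PROVED FOR THE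
MODEL FAMILY**: for every frame (block size, flow, window, Proposition-2.2/I.2.2 and scale constants) and every type of
outer sites, the family of all instances satisfies `Lemma24Printed`: one constant `C`, and for every instance obeying the
restrictions (2.55), `dev265a ≤ C·p(L^kε)`, `dev265b ≤ C·p(L^kε)`, `dev266 ≤ C·p(L^kε)`.
[cite: Balaban1982Higgs2, Lemma 2.4 (2.65)–(2.66) p. 572; proof (2.67)–(2.77) pp. 572–574] -/
theorem lemma24Printed_model {d : ℕ} (fr : Frame ι d) (Yo : Type) [Fintype Yo] [DecidableEq Yo] :
    B2.Lemma24Printed (famOf fr Yo) := by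
  obtain ⟨C, -, h⟩ := lemma24_bounds fr
  exact ⟨C, fun m hR => h Yo m hR⟩

end Final

end

end Literature.MathematicalPhysics.QuantumFieldTheory.Balaban1983to89.B2Lemma24Proof
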